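import Summits.ValiantsHypothesis.ValiantsHypothesis.Theorems.FifoMatchingNNDivisionHardLocatedFaceExposure
import Summits.ValiantsHypothesis.ValiantsHypothesis.Theorems.FifoMatchingXcDivisionChamberCertificate

/-!
# Sketch (val-idea-41 g3, W5-R1): the GENERATOR / FACE form of the located read — class E♯ and the parallelotope no-go

Typed companions of card `anchored-rows-kill-relaxations` rev 1.6 §(E).  Currency = the landed engine
`Theorems/FifoMatchingNNDivisionHardLocatedFaceExposure.lean` (val-idea-42 / val-idea-38 / crit-9 ADVISORY #2).
`BlockConstSymGen`, `Jdir`, `lvl`, `BlockBlind` are VERBATIM copies of the line `Lines/virtual_passenger.lean` (rev 11) decls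
(crux workfiles are cited, not imported; §11a pastes val-idea-40's genericity lemmas and one-cut rung VERBATIM, by name).
PROVED here (rev 4): `captureIffRefines`, `zonoGenBlindAt_of_not_covers`, `classZReduction` (P-R1d), `zonoEnemy_covers`, and ★
`zonoGenBlindAtDecided_holds` (P-R1b first link: the one-cut rung for zonotopes) with corollaries `classZ_of_covZonoHard :
CovZonoHard → ClassZ` and `zonoEnemy_covers'` ((Z1) unconditional); and (rev 5, §12) ★★ `fewZonesLaw_oneBlock : FewZonesLawOneBlock` —
THE FEW-ZONES LAW as a kernel theorem, via the ONE-BLOCK avoidance count `exists_oneBlock_avoiding` (which replaces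
`EquipartitionAvoidance` on the zonotope chapter).  The remaining statements are `def … : Prop`; nothing here is a summit statement;
21181 OPEN; `CovZonoHard` OPEN; VP ≠ VNP NOT proved.
-/

set_option autoImplicit false
set_option linter.dupNamespace false

noncomputable section
open Matrix Finset
open scoped Pointwise

namespace Summit.ValiantsHypothesis.ValiantsHypothesis.Cruxes.NNDivisionHard.FaceBlind41

open Literature.Barriers.PneNP (HasEFOfSize)
open Literature.Combinatorics.Optimization (corPolytopeGraph corVec)

variable {n m : ℕ}

/-- (line, verbatim) symmetric and `β`-block-constant. -/
def BlockConstSymGen (β : Fin n → Fin m) (g : Fin n × Fin n → ℝ) : Prop :=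
  (∀ p q, g (p, q) = g (q, p)) ∧ ∀ p q p' q', β p = β p' → β q = β q' → g (p, q) = g (p', q')

/-- (line, verbatim) the all-ones direction. -/
def Jdir (n : ℕ) : Fin n × Fin n → ℝ := fun _ => 1

/-- (line, verbatim) the block level `⌊√h⌋ − 2`. -/
def lvl (h : ℕ) : ℕ := Nat.sqrt h - 2

/-- (line, verbatim) CLASS E — block-blind in the VERTEX-DIFFERENCE proxy: ALL pairwise differences are tested. -/
def BlockBlind (h : ℕ) {J : Type} (q : J → (Fin h × Fin h → ℝ)) : Prop :=
  ∃ (β : Fin h → Fin (lvl h + 1)) (ρ : Fin (lvl h + 1) → Fin h), (∀ t, β (ρ t) = t) ∧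
    ∀ j j', BlockConstSymGen β (q j - q j') → ∃ α : ℝ, q j - q j' = α • Jdir h

/-- ITERATED-ARGMAX index sets of a finite family `q` — exactly the sets the engine `blockRead_iterate` visits (each step filters the
current set to the maximisers of a linear functional; stated extensionally, no decidability needed). -/
inductive IterArgmax {J : Type} [Fintype J] (q : J → (Fin n × Fin n → ℝ)) : Finset J → Prop
  | univ : IterArgmax q Finset.univ
  | step {Jk J' : Finset J} (φ : Fin n × Fin n → ℝ) (c : ℝ)
      (hmax : ∀ i ∈ Jk, φ ⬝ᵥ q i ≤ c) (hJ' : ∀ i, i ∈ J' ↔ i ∈ Jk ∧ φ ⬝ᵥ q i = c) (hne : J'.Nonempty) :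
      IterArgmax q Jk → IterArgmax q J'

/-- ★ CLASS E♯ — FACE-BLOCK-BLIND (the sharp, face form of E): for some coarse block map `β` with a section, on every iterated-argmax
index set whose pairwise differences are all symmetric `β`-block-constant, those differences are multiples of `J`.  This is EXACTLY the
hypothesis the proof of `locatedFaceExposureRung_holds` consumes (it invokes the J-multiple hypothesis only on the terminal set `J'` of
`blockRead_iterate`).  E ⊆ E♯ (`faceBlockBlind_of_blockBlind`); E♯ ∖ E contains every unimodular-for-rank-ones parallelotope (Π*), for
which class E fails at every `β` while E♯ holds at an equipartition-avoiding `β`. -/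
def FaceBlockBlind (h : ℕ) {J : Type} [Fintype J] (q : J → (Fin h × Fin h → ℝ)) : Prop :=
  ∃ (β : Fin h → Fin (lvl h + 1)) (ρ : Fin (lvl h + 1) → Fin h), (∀ t, β (ρ t) = t) ∧
    ∀ J' : Finset J, IterArgmax q J' →
      (∀ j ∈ J', ∀ j' ∈ J', BlockConstSymGen β (q j - q j')) →
      ∀ j ∈ J', ∀ j' ∈ J', ∃ α : ℝ, q j - q j' = α • Jdir h

/-- E ⊆ E♯ (trivial: E tests all pairs). -/
theorem faceBlockBlind_of_blockBlind (h : ℕ) {J : Type} [Fintype J] (q : J → (Fin h × Fin h → ℝ))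
    (hE : BlockBlind h q) : FaceBlockBlind h q := by
  obtain ⟨β, ρ, hρ, hJ⟩ := hE
  exact ⟨β, ρ, hρ, fun J' _ hbc j hj j' hj' => hJ j j' (hbc j hj j' hj')⟩

/-- ★ THE SHARP RUNG (prover food P3, ≈ 60 lines on top of the landed file): `locatedFaceExposureRung_holds` with the J-multiple
hypothesis asked only on iterated-argmax sets.  Proof plan: add `(hI : IterArgmax q Jk)` to the hypotheses and `IterArgmax q J'` to the
conclusion of `blockRead_iterate` (the `succ` step IS an argmax filter: `IterArgmax.step φ (φ ⬝ᵥ q j₀) …`); step 0 of the rung is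
`IterArgmax.step B (B ⬝ᵥ q j₀) … IterArgmax.univ`; the rest of the proof is unchanged. -/
def FaceLocatedExposureRung : Prop :=
  ∀ (n m : ℕ) (β : Fin n → Fin m) (ρ : Fin m → Fin n), (∀ t, β (ρ t) = t) →
    ∀ (K : ℕ) (q : Fin (K + 1) → (Fin n × Fin n → ℝ)) (r : ℕ),
      (∀ J' : Finset (Fin (K + 1)), IterArgmax q J' →
        (∀ j ∈ J', ∀ j' ∈ J', BlockConstSymGen β (q j - q j')) →
        ∀ j ∈ J', ∀ j' ∈ J', ∃ α : ℝ, q j - q j' = α • Jdir n) →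
      HasEFOfSize (corPolytopeGraph (⊤ : SimpleGraph (Fin n)) + convexHull ℝ (Set.range q)) r →
        ∃ q' : Fin 2 → (Fin m × Fin m → ℝ),
          HasEFOfSize (corPolytopeGraph (⊤ : SimpleGraph (Fin m)) + convexHull ℝ (Set.range q')) r

/-- ★ CLASS E♯ IS DECIDED (statement; = `FaceLocatedExposureRung` ∘ PROP A at `K = 2`, as `blockBlind_three_halves_pow_le`). -/
def FaceBlockBlindDecided : Prop :=
  ∀ (h K : ℕ) (q : Fin (K + 1) → (Fin h × Fin h → ℝ)) (r : ℕ), FaceBlockBlind h q →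
    HasEFOfSize (corPolytopeGraph (⊤ : SimpleGraph (Fin h)) + convexHull ℝ (Set.range q)) r →
      (3 / 2 : ℝ) ^ (lvl h) ≤ 2 * (r + 1)

/-! ## Zonotopal passengers: the read sees GENERATORS, not vertex differences -/

/-- the subset-sum (vertex) family of the zonotope `w + Σ_i [0,1]·gen i`, indexed by subsets of the generator index set. -/
def subsetSum {M : ℕ} (gen : Fin M → (Fin n × Fin n → ℝ)) (w : Fin n × Fin n → ℝ) :
    Finset (Fin M) → (Fin n × Fin n → ℝ) :=
  fun S => w + ∑ i ∈ S, gen i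

/-- ★ SUB-CUBE INVARIANT (statement; paper proof 5 lines: the maximisers of `φ` over the sub-cube `{S₀ ∪ T' : T' ⊆ T}` are
`{S₀ ∪ T₊ ∪ T'' : T'' ⊆ T⁰}`, `T₊ = {i ∈ T : φ·gen i > 0}`, `T⁰ = {i ∈ T : φ·gen i = 0}`): every iterated-argmax index set of a
subset-sum family is a sub-cube — so its pairwise differences include every single surviving generator `gen i`, `i ∈ T`. -/
def SubcubeInvariant : Prop :=
  ∀ (n M : ℕ) (gen : Fin M → (Fin n × Fin n → ℝ)) (w : Fin n × Fin n → ℝ) (J' : Finset (Finset (Fin M))),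
    IterArgmax (subsetSum gen w) J' →
      ∃ S₀ T : Finset (Fin M), Disjoint S₀ T ∧ ∀ S, S ∈ J' ↔ ∃ T' ⊆ T, S = S₀ ∪ T'

/-- ★ CLASS Z♭ — GENERATOR-BLIND ZONOTOPAL families (presentation-free in `q`: only the point SET matters): the hull of the family is a
zonotope `w + Σ_i [0,1]·gen i` (equality of HULLS, so vertex-presented zonotopes with dependent generators count) some coarse `β` of
which sees no `β`-block-constant GENERATOR off `ℝJ`.  Contains: every parallelotope
`Π_G` (any basis `G` of `Sym_h`, `h ≥ 16`), Π*, Π♮, `Z_mix`, `Z_s`, every zonotope with `< C(h′,t)/m` generator directions off `ℝJ`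
(by `EquipartitionAvoidance`, val-idea-38 `PairFace.lean` l.333, proof plan val-idea-40).  Z♭ ⊆ E♯ on the subset-sum presentation
(`SubcubeInvariant`), while Π* ∈ Z♭ ∖ E. -/
def ZonoGenBlind (h : ℕ) {J : Type} (q : J → (Fin h × Fin h → ℝ)) : Prop :=
  ∃ (β : Fin h → Fin (lvl h + 1)) (ρ : Fin (lvl h + 1) → Fin h), (∀ t, β (ρ t) = t) ∧
    ∃ (M : ℕ) (gen : Fin M → (Fin h × Fin h → ℝ)) (w : Fin h × Fin h → ℝ),
      convexHull ℝ (Set.range q) = convexHull ℝ (Set.range (subsetSum gen w)) ∧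
      ∀ i, BlockConstSymGen β (gen i) → ∃ α : ℝ, gen i = α • Jdir h

/-- ★ Z♭ IS DECIDED (statement; proof = `FaceLocatedExposureRung` on the subset-sum family `J = Finset (Fin M)` — the engine
`blockRead_iterate` is stated for an arbitrary index type — + `SubcubeInvariant` + PROP A at `K = 2`; `conv (range q)` is replaced by the
equal set `conv (range (subsetSum gen w))`). -/
def ZonoGenBlindDecided : Prop :=
  ∀ (h K : ℕ) (q : Fin (K + 1) → (Fin h × Fin h → ℝ)) (r : ℕ), ZonoGenBlind h q →
    HasEFOfSize (corPolytopeGraph (⊤ : SimpleGraph (Fin h)) + convexHull ℝ (Set.range q)) r →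
      (3 / 2 : ℝ) ^ (lvl h) ≤ 2 * (r + 1)

/-- ★ FEW-GENERATOR ZONOTOPE LAW = THE PARALLELOTOPE NO-GO (statement, UNBUDGETED; = `EquipartitionAvoidance` ∘ `ZonoGenBlindDecided`,
leftover indices `p ≥ m·t` merged into the last block; generators `∝ J` are harmless and simply counted): a zonotopal passenger with
`M` generators, `M·m < C(m·t, t)`, `m = lvl h + 1`, `t = ⌊h/m⌋`, obeys the class-E rate.  Every BASIS of `Sym_h` has `M ≤ h(h+1)/2`, and
`h(h+1)/2 · m < C(m t, t)` for all `h ≥ 16` (`native_decide` instance below at `h = 16`): NO parallelotope is a member of the residual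
core — the W5-R1 «parallelotope enemy» does not exist. -/
def FewGeneratorZonotopeLaw : Prop :=
  ∀ (h M : ℕ) (gen : Fin M → (Fin h × Fin h → ℝ)) (w : Fin h × Fin h → ℝ) (r : ℕ),
    M * (lvl h + 1) < Nat.choose ((lvl h + 1) * (h / (lvl h + 1))) (h / (lvl h + 1)) →
    HasEFOfSize (corPolytopeGraph (⊤ : SimpleGraph (Fin h)) + convexHull ℝ (Set.range (subsetSum gen w))) r →
      (3 / 2 : ℝ) ^ (lvl h) ≤ 2 * (r + 1)

/-- the count at the first nontrivial level `h = 16` (`lvl 16 = 2`, `m = 3`, `t = 5`): `136 · 3 = 408 < C(15,5) = 3003`. -/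
example : (16 * 17 / 2) * (lvl 16 + 1) < Nat.choose ((lvl 16 + 1) * (16 / (lvl 16 + 1))) (16 / (lvl 16 + 1)) := by
  native_decide

/-- … and at `h = 64` (`m = 7`, `t = 9`): `2080 · 7 = 14560 < C(63,9)`. -/
example : (64 * 65 / 2) * (lvl 64 + 1) < Nat.choose ((lvl 64 + 1) * (64 / (lvl 64 + 1))) (64 / (lvl 64 + 1)) := by
  native_decide

/-! ## What a zonotopal test member of the residual must carry instead (card §(E3)): 2-class step kernels are CUT-SIGNED -/

/-- the single-edge cut row `δ_ij(y) = y_ii + y_jj − 2 y_ij` (the line's `cutDirG i j ⬝ᵥ y`, spelled out). -/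
def cutVal (i j : Fin n) (y : Fin n × Fin n → ℝ) : ℝ := y (i, i) + y (j, j) - 2 * y (i, j)

/-- ★ (statement, one line of algebra) a 2-CLASS STEP KERNEL `g = x·P_A + y·P_{Aᶜ} + z·J` takes the SAME value `x + y` on every edge
cut crossing `A` and `0` on every other edge: it is cut-signed, so a zonotope all of whose `β`-capturing generators are 2-class reads, at
level `m`, to a CUT-DOMINANT (class K) passenger — decided modulo KMR.  Enemy capturing generators need ≥ 3 clone classes with quotient
pair values `x_aa + x_bb − 2 x_ab` of both signs. -/
def TwoClassKernelCutSigned : Prop :=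
  ∀ (n : ℕ) (A : Finset (Fin n)) (x y z : ℝ) (i j : Fin n), i ≠ j →
    cutVal i j (fun pq => (if pq.1 ∈ A ∧ pq.2 ∈ A then x else 0) + (if pq.1 ∉ A ∧ pq.2 ∉ A then y else 0) + z) =
      if (i ∈ A ↔ j ∈ A) then 0 else x + y

theorem twoClassKernelCutSigned : TwoClassKernelCutSigned := by
  intro n A x y z i j hij
  unfold cutVal
  by_cases hi : i ∈ A <;> by_cases hj : j ∈ A <;> simp [hi, hj] <;> ring

/-! ## (E4) Capture = refinement · the level-`m′` few-zones law · the COR-free reduction of the zonotope chapter (card rev 1.7) -/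

/-- rows `p` and `p'` of `g` coincide. -/
def SameRow (g : Fin n × Fin n → ℝ) (p p' : Fin n) : Prop := ∀ q, g (p, q) = g (p', q)

/-- ★ CAPTURE = REFINEMENT: a symmetric `g` is `β`-block-constant iff `β` refines the ROW PARTITION of `g` (rows equal within blocks).
So «generator `g` is captured by `β`» is the lattice statement `blocks(β) ≤ 𝒜(g)`, and a zone family is β-covering iff its row partitions
cover level `m′` of the partition lattice from above. -/
def CaptureIffRefines : Prop :=
  ∀ (n m : ℕ) (β : Fin n → Fin m) (g : Fin n × Fin n → ℝ), (∀ p q, g (p, q) = g (q, p)) →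
    (BlockConstSymGen β g ↔ ∀ p p', β p = β p' → SameRow g p p')

theorem captureIffRefines : CaptureIffRefines := by
  intro n m β g hsym
  constructor
  · rintro ⟨-, hbc⟩ p p' hpp' q
    exact hbc p q p' q hpp' rfl
  · intro H
    refine ⟨hsym, fun p q p' q' hp hq => ?_⟩
    rw [H p p' hp q, hsym p' q, H q q' hq p', hsym q' p']

/-- the zone family `gen` COVERS level `m'`: every surjection `β : [h] ↠ [m']` captures some zone off `ℝJ`. -/
def Covers (h m' : ℕ) {M : ℕ} (gen : Fin M → (Fin h × Fin h → ℝ)) : Prop :=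
  ∀ β : Fin h → Fin m', Function.Surjective β →
    ∃ i, BlockConstSymGen β (gen i) ∧ ¬ ∃ α : ℝ, gen i = α • Jdir h

/-- level-parametrised Z♭: generator-blind at SOME surjection onto `m'` blocks (`m' = lvl h + 1` is `ZonoGenBlind`). -/
def ZonoGenBlindAt (h m' : ℕ) {J : Type} (q : J → (Fin h × Fin h → ℝ)) : Prop :=
  ∃ (β : Fin h → Fin m') (ρ : Fin m' → Fin h), (∀ t, β (ρ t) = t) ∧
    ∃ (M : ℕ) (gen : Fin M → (Fin h × Fin h → ℝ)) (w : Fin h × Fin h → ℝ),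
      convexHull ℝ (Set.range q) = convexHull ℝ (Set.range (subsetSum gen w)) ∧
      ∀ i, BlockConstSymGen β (gen i) → ∃ α : ℝ, gen i = α • Jdir h

/-- DICHOTOMY GLUE (checked): a zonotopal family that does not cover level `m'` is generator-blind at level `m'`. -/
theorem zonoGenBlindAt_of_not_covers (h m' : ℕ) {J : Type} (q : J → (Fin h × Fin h → ℝ)) {M : ℕ}
    (gen : Fin M → (Fin h × Fin h → ℝ)) (w : Fin h × Fin h → ℝ)
    (hhull : convexHull ℝ (Set.range q) = convexHull ℝ (Set.range (subsetSum gen w)))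
    (hnc : ¬ Covers h m' gen) : ZonoGenBlindAt h m' q := by
  unfold Covers at hnc
  push Not at hnc
  obtain ⟨β, hβ, hblind⟩ := hnc
  exact ⟨β, Function.surjInv hβ, fun t => Function.surjInv_eq hβ t, M, gen, w, hhull, hblind⟩

/-- ★ Z♭ AT LEVEL `m'` IS DECIDED at rate `(3/2)^(m'-1)` (statement; same proof as `ZonoGenBlindDecided` with `β : [h] ↠ [m']`; the route
needs only `m' = m_min(n,c) ≈ 1.71·(log₂ n + c)^c + 3`). -/
def ZonoGenBlindAtDecided : Prop :=
  ∀ (h m' K : ℕ) (q : Fin (K + 1) → (Fin h × Fin h → ℝ)) (r : ℕ), ZonoGenBlindAt h m' q →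
    HasEFOfSize (corPolytopeGraph (⊤ : SimpleGraph (Fin h)) + convexHull ℝ (Set.range q)) r →
      (3 / 2 : ℝ) ^ (m' - 1) ≤ 2 * (r + 1)

/-- ★ FEW-ZONES LAW AT LEVEL `m'` (statement, UNBUDGETED; = `EquipartitionAvoidance` at `t = ⌊h/m'⌋` ∘ `ZonoGenBlindAtDecided`): fewer than
`C(m'·t, t)/m'` zones ⇒ decided at rate `(3/2)^(m'-1)`.  At `m' = m_min = polylog h` the threshold is `2^{(h/m')·log₂(e m')(1−o(1))} =
2^{h^{1−o(1)}}`: EVERY zonotopal passenger with at most `2^{h^{1−ε}}` zones is decided. -/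
def FewZonesLawAt : Prop :=
  ∀ (h m' M : ℕ) (gen : Fin M → (Fin h × Fin h → ℝ)) (w : Fin h × Fin h → ℝ) (r : ℕ), 2 ≤ h / m' →
    M * m' < Nat.choose (m' * (h / m')) (h / m') →
    HasEFOfSize (corPolytopeGraph (⊤ : SimpleGraph (Fin h)) + convexHull ℝ (Set.range (subsetSum gen w))) r →
      (3 / 2 : ℝ) ^ (m' - 1) ≤ 2 * (r + 1)

/-- ★ CLASS Z (statement): every SYMMETRIC-zone zonotopal passenger obeys the law in the crux's shape — budget `r` on the passenger, conclusion
`2^{(log₂ h + C)^C} < r` once `COR(K_h) + Z` also fits in `r`. -/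
def ClassZ : Prop :=
  ∀ C : ℕ, ∃ h₀ : ℕ, ∀ h ≥ h₀, ∀ (M : ℕ) (gen : Fin M → (Fin h × Fin h → ℝ)) (w : Fin h × Fin h → ℝ) (r : ℕ),
    (∀ i p q, gen i (p, q) = gen i (q, p)) →
    HasEFOfSize (convexHull ℝ (Set.range (subsetSum gen w))) r →
    HasEFOfSize (corPolytopeGraph (⊤ : SimpleGraph (Fin h)) + convexHull ℝ (Set.range (subsetSum gen w))) r →
      2 ^ ((Nat.log 2 h + C) ^ C) < r

/-- ★★ `CovZonoHard` — the COR-FREE CONJECTURE the zonotope chapter reduces to: a zonotope in `Sym_h` whose zones' row partitions cover level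
`m' = 2·(log₂ h + C)^C + 4` (≥ `m_min`) of the partition lattice is NOT budgeted: `xc > 2^{(log₂ h + C)^C}`.  No `COR`, no permanent, no
circuit in the statement — an extension-complexity lower bound for an explicit, highly constrained class of zonotopes (≥ `2^{h^{1−o(1)}}` zones by
`FewZonesLawAt`'s count, not confined to few low-dimensional flats by the flat lemma of the card). -/
def CovZonoHard : Prop :=
  ∀ C : ℕ, ∃ h₀ : ℕ, ∀ h ≥ h₀, ∀ (M : ℕ) (gen : Fin M → (Fin h × Fin h → ℝ)) (w : Fin h × Fin h → ℝ) (r : ℕ),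
    (∀ i p q, gen i (p, q) = gen i (q, p)) →
    Covers h (2 * (Nat.log 2 h + C) ^ C + 4) gen →
    HasEFOfSize (convexHull ℝ (Set.range (subsetSum gen w))) r → 2 ^ ((Nat.log 2 h + C) ^ C) < r

/-- ★ THE REDUCTION (statement of the glue; proof = `zonoGenBlindAt_of_not_covers` + `ZonoGenBlindAtDecided` at `m' = 2(log₂ h + C)^C + 4` +
the arithmetic `(3/2)^{m'−1} > 2·2^{(log₂ h + C)^C} + 2`, eventually in `h`): the zonotope chapter of COR-MINKOWSKI is `CovZonoHard`. -/
def ClassZReduction : Prop := CovZonoHard → ZonoGenBlindAtDecided → ClassZ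

/-! ## 9. P-R1d (crit-9 VERDICT #17): the reduction glue BY NAME, in kernel

The arithmetic: at `L = (log₂ h + C)^C ≥ 1` and reduction level `m' = 2L + 4`, the decided branch gives
`(3/2)^{2L+3} = (27/8)·(9/4)^L ≤ 2(r+1)`, incompatible with `r ≤ 2^L`.  No threshold in `h` is needed on this branch. -/

theorem one_le_L (h C : ℕ) : 1 ≤ (Nat.log 2 h + C) ^ C := by
  rcases Nat.eq_zero_or_pos C with rfl | hC
  · simp
  · exact Nat.one_le_pow _ _ (by omega)

/-- the decided (generator-blind) branch of the reduction: `¬ Covers` at level `2L + 4` forces `2^L < r` for the COR-sum. -/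
theorem lt_of_not_covers (hDec : ZonoGenBlindAtDecided) (C h : ℕ) {M : ℕ} (gen : Fin M → (Fin h × Fin h → ℝ))
    (w : Fin h × Fin h → ℝ) (r : ℕ) (hc : ¬ Covers h (2 * (Nat.log 2 h + C) ^ C + 4) gen)
    (hR : HasEFOfSize (corPolytopeGraph (⊤ : SimpleGraph (Fin h)) + convexHull ℝ (Set.range (subsetSum gen w))) r) :
    2 ^ ((Nat.log 2 h + C) ^ C) < r := by
  set L := (Nat.log 2 h + C) ^ C with hLdef
  have hblind : ZonoGenBlindAt h (2 * L + 4) (subsetSum gen w) :=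
    zonoGenBlindAt_of_not_covers h (2 * L + 4) (subsetSum gen w) gen w rfl hc
  -- reindex the subset-sum family by `Fin (K + 1)`
  obtain ⟨K, ⟨e⟩⟩ : ∃ K, Nonempty (Finset (Fin M) ≃ Fin (K + 1)) := by
    refine ⟨Fintype.card (Finset (Fin M)) - 1, ⟨(Fintype.equivFin _).trans (finCongr ?_)⟩⟩
    have : 0 < Fintype.card (Finset (Fin M)) := Fintype.card_pos
    omega
  have hq : Set.range (subsetSum gen w ∘ e.symm) = Set.range (subsetSum gen w) :=
    Function.Surjective.range_comp e.symm.surjective _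
  have hblind' : ZonoGenBlindAt h (2 * L + 4) (subsetSum gen w ∘ e.symm) := by
    obtain ⟨β, ρ, hρ, M', gen', w', hhull, hbl⟩ := hblind
    exact ⟨β, ρ, hρ, M', gen', w', by rw [hq]; exact hhull, hbl⟩
  have hR' : HasEFOfSize (corPolytopeGraph (⊤ : SimpleGraph (Fin h)) +
      convexHull ℝ (Set.range (subsetSum gen w ∘ e.symm))) r := by
    rw [hq]; exact hR
  have hdec := hDec h (2 * L + 4) K (subsetSum gen w ∘ e.symm) r hblind' hR'
  have hm : 2 * L + 4 - 1 = 2 * L + 3 := by omega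
  rw [hm] at hdec
  have hL : 1 ≤ L := one_le_L h C
  have h1 : (2 : ℝ) ≤ 2 ^ L := by
    calc (2 : ℝ) = 2 ^ 1 := by norm_num
      _ ≤ 2 ^ L := pow_le_pow_right₀ (by norm_num) hL
  have h2 : (2 : ℝ) ^ L ≤ (9 / 4) ^ L := pow_le_pow_left₀ (by norm_num) (by norm_num) L
  have key : (3 / 2 : ℝ) ^ (2 * L + 3) = (9 / 4) ^ L * (27 / 8) := by
    rw [pow_add, pow_mul]; norm_num
  rw [key] at hdec
  have hlt : (2 : ℝ) ^ L < r := by linarith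
  exact_mod_cast hlt

/-- ★ P-R1d PAID: `ClassZ ⇐ CovZonoHard ∧ ZonoGenBlindAtDecided`, glue by name. -/
theorem classZReduction : ClassZReduction := by
  intro hCov hDec C
  obtain ⟨h₁, hh₁⟩ := hCov C
  refine ⟨h₁, fun h hh M gen w r hsym hZ hR => ?_⟩
  by_cases hc : Covers h (2 * (Nat.log 2 h + C) ^ C + 4) gen
  · exact hh₁ h hh M gen w r hsym hc hZ
  · exact lt_of_not_covers hDec C h gen w r hc hR

/-! ## 10. (E5) THE ZONOTOPE RESIDUAL OF RECORD — one typed line (P-R2c, joint val-idea-41 g3 × val-idea-44 g0)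

A zonotopal ENEMY at parameter `C` and height `h` is a symmetric-zone zonotope that is a budgeted passenger AND keeps the COR-sum within
budget.  The SPEC lists what the record forces on it: (Z1) COVERING at the reduction level (41 (E4), kernel below modulo the one-cut rung);
(Z2) every captured non-`J` zone EDGE-SIGN-MIXED, hence indefinite (41 (E3)(c)/(E4.6): cut-signed captured zones read to class K; ±PSD
zones are 38's `PSDZonotopeRung`); (Z3) FAN-CHEAP (44 N13): every tangent cone at a subset-sum point has an EF of size `≤ r + 1`
(44 `TangentConeEF`, whose `tangentCone` is copied verbatim below; listed because it is the form in which cone pricing reads — and provably cannot refute — the enemy).  `Z_cor` meets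
(Z1)(Z2)(Z3) on paper; whether it meets the budget clause is `CovZonoHard`'s first instance. -/

/-- verbatim copy of val-idea-44 g0's `ConePricing44.tangentCone` (that Cruxes module is not in the farm's build closure, so it is not
importable here): the tangent (= feasible-directions) cone of `P` at `v`, `{t·(p − v) : t ≥ 0, p ∈ P}`. -/
def tangentCone {ι : Type} (P : Set (ι → ℝ)) (v : ι → ℝ) : Set (ι → ℝ) :=
  {x | ∃ t : ℝ, 0 ≤ t ∧ ∃ p ∈ P, x = t • (p - v)}

/-- a symmetric direction is EDGE-SIGN-MIXED: the cut functional `δ_{pq}·g = g_pp + g_qq − 2·g_pq` takes both strict signs. -/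
def EdgeSignMixed {h : ℕ} (g : Fin h × Fin h → ℝ) : Prop :=
  (∃ p q : Fin h, p ≠ q ∧ 0 < cutVal p q g) ∧ (∃ p q : Fin h, p ≠ q ∧ cutVal p q g < 0)

/-- a zonotopal ENEMY (budgeted counterexample candidate) at `(C, h)`. -/
def ZonoEnemy (C h : ℕ) {M : ℕ} (gen : Fin M → (Fin h × Fin h → ℝ)) (w : Fin h × Fin h → ℝ) (r : ℕ) : Prop :=
  (∀ i p q, gen i (p, q) = gen i (q, p)) ∧ r ≤ 2 ^ ((Nat.log 2 h + C) ^ C) ∧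
    HasEFOfSize (convexHull ℝ (Set.range (subsetSum gen w))) r ∧
    HasEFOfSize (corPolytopeGraph (⊤ : SimpleGraph (Fin h)) + convexHull ℝ (Set.range (subsetSum gen w))) r

/-- (E5) the residual SPEC of record: (Z1) ∧ (Z2) ∧ (Z3). -/
def ZonoResidualSpec (C h : ℕ) {M : ℕ} (gen : Fin M → (Fin h × Fin h → ℝ)) (w : Fin h × Fin h → ℝ) (r : ℕ) : Prop :=
  Covers h (2 * (Nat.log 2 h + C) ^ C + 4) gen ∧
  (∀ β : Fin h → Fin (2 * (Nat.log 2 h + C) ^ C + 4), Function.Surjective β →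
      ∀ i, BlockConstSymGen β (gen i) → (∃ α : ℝ, gen i = α • Jdir h) ∨ EdgeSignMixed (gen i)) ∧
  (∀ S : Finset (Fin M),
      HasEFOfSize (tangentCone (convexHull ℝ (Set.range (subsetSum gen w))) (subsetSum gen w S)) (r + 1))

/-- (E5) LAW (statement): every zonotopal enemy meets the spec — (Z1) by `zonoEnemy_covers` below (modulo `ZonoGenBlindAtDecided`),
(Z2) by class K (paper), (Z3) by `ConePricing44.TangentConeEF` (paper). -/
def ZonoResidualLaw : Prop :=
  ∀ (C h M : ℕ) (gen : Fin M → (Fin h × Fin h → ℝ)) (w : Fin h × Fin h → ℝ) (r : ℕ),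
    ZonoEnemy C h gen w r → ZonoResidualSpec C h gen w r

/-- (Z1) in kernel modulo the one-cut rung: a budgeted enemy COVERS the reduction level, at every `h` (no threshold). -/
theorem zonoEnemy_covers (hDec : ZonoGenBlindAtDecided) (C h : ℕ) {M : ℕ} (gen : Fin M → (Fin h × Fin h → ℝ))
    (w : Fin h × Fin h → ℝ) (r : ℕ) (hE : ZonoEnemy C h gen w r) :
    Covers h (2 * (Nat.log 2 h + C) ^ C + 4) gen := by
  by_contra hc
  obtain ⟨_, hr, _, hR⟩ := hE
  exact absurd (lt_of_not_covers hDec C h gen w r hc hR) (not_lt.mpr hr)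

/-- sanity: the corona zone `g_{A,B}` with `A = {0}`, `B = {1}` in `Sym_3` is edge-sign-mixed
(`δ_{02}·g = 1 > 0`, `δ_{01}·g = 1 + 0 − 2 = −1 < 0`). -/
example : EdgeSignMixed (h := 3) (fun pq => if (pq.1 = 0 ∧ pq.2 = 0) ∨ (pq.1 = 0 ∧ pq.2 = 1) ∨ (pq.1 = 1 ∧ pq.2 = 0) then 1 else 0) := by
  refine ⟨⟨0, 2, by decide, ?_⟩, ⟨0, 1, by decide, ?_⟩⟩ <;> simp [cutVal]


/-! ## 11. P-R1b, first link — the ONE-CUT RUNG FOR ZONOTOPES in kernel: `zonoGenBlindAtDecided_holds`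

(crit-9 VERDICT #17/#31: «`ZonoGenBlindAtDecided` ≈ 40's `exists_generic_comb` + ONE `face_add_face₁` + PROP A at K = 2».)
§11a pastes val-idea-40's genericity lemmas (`DimensionRung.lean`, g2) and one-cut rung (`ExposedFibre.lean` rev 3 §0–§1b,
g3) VERBATIM — cited by paste because Cruxes modules are not importable on the farm; §11b is new: a generic ADMISSIBLE
direction separating every non-`W_β` zone (`exists_admissible_sep`), the exchange argument on maximising subset sums, and the
assembly. -/

section PastedFromValIdea40
open Summit.ValiantsHypothesis.ValiantsHypothesis.Theorems.FifoMatching.LocatedFaceExposure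
open Summit.ValiantsHypothesis.ValiantsHypothesis.Theorems.FifoMatching.XcDivision

/-- [val-idea-40 g2, `DimensionRung.lean`, verbatim] a real `M > C` with `α M + β ≠ 0` for finitely many `(α, β) ≠ 0`. -/
theorem exists_large_avoid (s : Finset (ℝ × ℝ)) (hs : ∀ p ∈ s, p.1 ≠ 0 ∨ p.2 ≠ 0) (C : ℝ) :
    ∃ M : ℝ, C < M ∧ ∀ p ∈ s, p.1 * M + p.2 ≠ 0 := by
  refine ⟨|C| + 1 + ∑ p ∈ s, |p.2 / p.1|, ?_, ?_⟩
  · have h1 : C ≤ |C| := le_abs_self C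
    have h2 : 0 ≤ ∑ p ∈ s, |p.2 / p.1| := Finset.sum_nonneg fun p _ => abs_nonneg _
    linarith
  · intro p hp
    rcases eq_or_ne p.1 0 with h0 | h0
    · rcases hs p hp with h | h
      · exact absurd h0 h
      · rw [h0, zero_mul, zero_add]; exact h
    · have hle : |p.2 / p.1| ≤ ∑ p ∈ s, |p.2 / p.1| :=
        Finset.single_le_sum (f := fun p : ℝ × ℝ => |p.2 / p.1|) (fun p _ => abs_nonneg _) hp
      have hC : 0 ≤ |C| := abs_nonneg C
      have hge : -|p.2 / p.1| ≤ p.2 / p.1 := neg_abs_le _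
      have hpos : 0 < |C| + 1 + ∑ p ∈ s, |p.2 / p.1| + p.2 / p.1 := by linarith
      have heq : p.1 * (|C| + 1 + ∑ p ∈ s, |p.2 / p.1|) + p.2 =
          p.1 * (|C| + 1 + ∑ p ∈ s, |p.2 / p.1| + p.2 / p.1) := by
        field_simp
      rw [heq]
      exact mul_ne_zero h0 hpos.ne'

/-- [val-idea-40 g2, `DimensionRung.lean`, verbatim] a GENERIC combination of finitely many test functions separates every
test point that some test function sees. -/
theorem exists_generic_comb {K E : Type} [Fintype K] [DecidableEq K] (T : Finset E) (ψ : K → E → ℝ) :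
    ∃ ε : K → ℝ, ∀ Δ ∈ T, (∃ t, ψ t Δ ≠ 0) → ∑ t, ε t * ψ t Δ ≠ 0 := by
  classical
  suffices h : ∀ s : Finset K, ∃ ε : K → ℝ, (∀ t ∉ s, ε t = 0) ∧
      ∀ Δ ∈ T, (∃ t ∈ s, ψ t Δ ≠ 0) → ∑ t, ε t * ψ t Δ ≠ 0 by
    obtain ⟨ε, -, hε⟩ := h Finset.univ
    exact ⟨ε, fun Δ hΔ ⟨t, ht⟩ => hε Δ hΔ ⟨t, Finset.mem_univ t, ht⟩⟩
  intro s
  induction s using Finset.induction_on with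
  | empty =>
    exact ⟨0, fun _ _ => rfl, fun Δ _ ⟨t, ht, _⟩ => absurd ht (by simp)⟩
  | insert a s ha ih =>
    obtain ⟨ε', hsupp, hsep⟩ := ih
    let pr : E → ℝ × ℝ := fun Δ => (ψ a Δ, ∑ t, ε' t * ψ t Δ)
    obtain ⟨τ, -, hτ⟩ := exists_large_avoid ((T.image pr).filter fun p => p.1 ≠ 0 ∨ p.2 ≠ 0)
      (fun p hp => (Finset.mem_filter.1 hp).2) 0
    refine ⟨fun t => ε' t + (if t = a then τ else 0), ?_, ?_⟩
    · intro t ht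
      rw [Finset.mem_insert, not_or] at ht
      show ε' t + (if t = a then τ else 0) = 0
      rw [hsupp t ht.2, if_neg ht.1, add_zero]
    · intro Δ hΔ hex
      have hsum : ∑ t, (ε' t + (if t = a then τ else 0)) * ψ t Δ =
          (∑ t, ε' t * ψ t Δ) + τ * ψ a Δ := by
        simp only [add_mul, Finset.sum_add_distrib, ite_mul, zero_mul, Finset.sum_ite_eq',
          Finset.mem_univ, if_true]
      rw [hsum]
      by_cases hpair : ψ a Δ ≠ 0 ∨ ∑ t, ε' t * ψ t Δ ≠ 0
      · have hmem : pr Δ ∈ (T.image pr).filter fun p => p.1 ≠ 0 ∨ p.2 ≠ 0 :=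
          Finset.mem_filter.2 ⟨Finset.mem_image_of_mem pr hΔ, hpair⟩
        have hne := hτ (pr Δ) hmem
        intro h0
        apply hne
        show ψ a Δ * τ + ∑ t, ε' t * ψ t Δ = 0
        linarith
      · push Not at hpair
        obtain ⟨t, ht, hne⟩ := hex
        rw [Finset.mem_insert] at ht
        rcases ht with rfl | ht
        · exact absurd hpair.1 hne
        · exact absurd hpair.2 (hsep Δ hΔ ⟨t, ht, hne⟩)

/-- [val-idea-40 g3, `ExposedFibre.lean` §0, verbatim] a `0/1` vector constant on the blocks of `β`. -/
def BlockConst (β : Fin n → Fin m) (b : Fin n → Bool) : Prop := ∀ p q, β p = β q → b p = b q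

/-- [40 §0, verbatim] ADMISSIBLE (located) direction for `F_β`: vanishes on the block-constant vertices of `COR(K_n)` and is
strictly negative on every other vertex. -/
def Admissible (β : Fin n → Fin m) (c : Fin n × Fin n → ℝ) : Prop :=
  (∀ b, BlockConst β b → c ⬝ᵥ corVec (⊤ : SimpleGraph (Fin n)) b = 0) ∧
  (∀ b, ¬ BlockConst β b → c ⬝ᵥ corVec (⊤ : SimpleGraph (Fin n)) b < 0)

/-- [40 §0, verbatim] the engine's direction `C₀^β` is admissible. -/
theorem admissible_blockDir (β : Fin n → Fin m) : ∃ c : Fin n × Fin n → ℝ, Admissible β c := by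
  obtain ⟨B, hB⟩ := exists_blockDir (n := n) (m := m) β
  refine ⟨B, fun b hb => dot_eq_zero_of_blockConst β hB hb, fun b hb => ?_⟩
  rcases (blockDir_dot_corVec_le β hB b).lt_or_eq with h | h
  · exact h
  · exact absurd (blockConst_of_dot_eq_zero β hB h) hb

/-- [40 §1, verbatim] CLASS E♭ — some admissible direction whose maximisers among the `q j` pairwise differ by multiples of `J`. -/
def ExposedFibreBlind (β : Fin n → Fin m) {J : Type} (q : J → (Fin n × Fin n → ℝ)) : Prop :=
  ∃ c : Fin n × Fin n → ℝ, Admissible β c ∧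
    ∀ j j', (∀ k, c ⬝ᵥ q k ≤ c ⬝ᵥ q j) → (∀ k, c ⬝ᵥ q k ≤ c ⬝ᵥ q j') → ∃ α : ℝ, q j - q j' = α • Jdir n

/-- [40 §1, verbatim] ONE-CUT RUNG. -/
def ExposedFibreRung : Prop :=
  ∀ (n m : ℕ) (β : Fin n → Fin m) (ρ : Fin m → Fin n), (∀ t, β (ρ t) = t) →
    ∀ (K : ℕ) (q : Fin (K + 1) → (Fin n × Fin n → ℝ)) (r : ℕ),
      ExposedFibreBlind β q →
      HasEFOfSize (corPolytopeGraph (⊤ : SimpleGraph (Fin n)) + convexHull ℝ (Set.range q)) r →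
        ∃ q' : Fin 2 → (Fin m × Fin m → ℝ),
          HasEFOfSize (corPolytopeGraph (⊤ : SimpleGraph (Fin m)) + convexHull ℝ (Set.range q')) r

/-- [40 §1, verbatim] … hence the count `3^m ≤ (r+1)·2^(m+1)`. -/
def ExposedFibreDecided : Prop :=
  ∀ (n m : ℕ) (β : Fin n → Fin m) (ρ : Fin m → Fin n), (∀ t, β (ρ t) = t) →
    ∀ (K : ℕ) (q : Fin (K + 1) → (Fin n × Fin n → ℝ)) (r : ℕ),
      ExposedFibreBlind β q →
      HasEFOfSize (corPolytopeGraph (⊤ : SimpleGraph (Fin n)) + convexHull ℝ (Set.range q)) r →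
        3 ^ m ≤ (r + 1) * 2 ^ (m + 1)

/-- [40 §1b, verbatim] -/
theorem Admissible.dot_eq_zero_iff {β : Fin n → Fin m} {c : Fin n × Fin n → ℝ} (hc : Admissible β c)
    (b : Fin n → Bool) : c ⬝ᵥ corVec (⊤ : SimpleGraph (Fin n)) b = 0 ↔ BlockConst β b := by
  constructor
  · intro h
    by_contra hb
    exact (hc.2 b hb).ne h
  · exact hc.1 b

/-- [40 §1b, verbatim] -/
theorem Admissible.dot_le {β : Fin n → Fin m} {c : Fin n × Fin n → ℝ} (hc : Admissible β c)
    (b : Fin n → Bool) : c ⬝ᵥ corVec (⊤ : SimpleGraph (Fin n)) b ≤ 0 := by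
  by_cases hb : BlockConst β b
  · exact (hc.1 b hb).le
  · exact (hc.2 b hb).le

/-- [40 §1b, verbatim] the `c`-face of `COR(K_n)` IS the contraction face `F_β`. -/
theorem Admissible.face_eq {β : Fin n → Fin m} {c : Fin n × Fin n → ℝ} (hc : Admissible β c)
    {B : Fin n × Fin n → ℝ}
    (hB : ∀ x : Fin n × Fin n → ℝ,
      B ⬝ᵥ x = ∑ p : Fin n, ∑ q : Fin n, if β q = β p ∧ q ≠ p then x (p, q) - x (p, p) else 0) :
    corPolytopeGraph (⊤ : SimpleGraph (Fin n)) ∩ {x | c ⬝ᵥ x = 0} =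
      corPolytopeGraph (⊤ : SimpleGraph (Fin n)) ∩ {x | B ⬝ᵥ x = 0} := by
  unfold corPolytopeGraph
  rw [convexHull_range_inter_eq _ c 0 hc.dot_le, convexHull_range_inter_eq _ B 0 (blockDir_dot_corVec_le β hB)]
  congr 1
  ext x
  simp only [Set.mem_range]
  constructor
  · rintro ⟨⟨b, hb⟩, rfl⟩
    exact ⟨⟨b, dot_eq_zero_of_blockConst β hB ((hc.dot_eq_zero_iff b).1 hb)⟩, rfl⟩
  · rintro ⟨⟨b, hb⟩, rfl⟩
    exact ⟨⟨b, (hc.dot_eq_zero_iff b).2 (blockConst_of_dot_eq_zero β hB hb)⟩, rfl⟩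

open Classical in
/-- [40 §1b, verbatim] ★ THE ONE-CUT RUNG HOLDS. -/
theorem exposedFibreRung_holds : ExposedFibreRung := by
  intro n m β ρ hρ K q r hE hEF
  obtain ⟨c, hc, hthin⟩ := hE
  obtain ⟨B, hB⟩ := exists_blockDir β
  obtain ⟨j₀, -, hmax⟩ :=
    Finset.exists_max_image Finset.univ (fun j => c ⬝ᵥ q j) Finset.univ_nonempty
  have hQ : ∀ y ∈ convexHull ℝ (Set.range q), c ⬝ᵥ y ≤ c ⬝ᵥ q j₀ :=
    dot_le_of_mem_convexHull _ _ _ (by rintro _ ⟨j, rfl⟩; exact hmax j (Finset.mem_univ _))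
  have hP : ∀ x ∈ corPolytopeGraph (⊤ : SimpleGraph (Fin n)), c ⬝ᵥ x ≤ 0 :=
    dot_le_of_mem_convexHull _ _ _ (by rintro _ ⟨b, rfl⟩; exact hc.dot_le b)
  have h0 := hEF.face_add_face₁ c 0 (c ⬝ᵥ q j₀) hP hQ
  rw [hc.face_eq hB] at h0
  have hQeq : convexHull ℝ (Set.range q) ∩ {y | c ⬝ᵥ y = c ⬝ᵥ q j₀} =
      convexHull ℝ (q '' ((Finset.univ.filter fun j => c ⬝ᵥ q j = c ⬝ᵥ q j₀ : Finset (Fin (K + 1))) :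
        Set (Fin (K + 1)))) := by
    rw [convexHull_range_inter_eq q c _ (fun j => hmax j (Finset.mem_univ _))]
    congr 1
    ext y
    constructor
    · rintro ⟨⟨j, hj⟩, rfl⟩
      exact ⟨j, Finset.mem_coe.2 (Finset.mem_filter.2 ⟨Finset.mem_univ _, hj⟩), rfl⟩
    · rintro ⟨j, hj, rfl⟩
      exact ⟨⟨j, (Finset.mem_filter.1 (Finset.mem_coe.1 hj)).2⟩, rfl⟩
  rw [hQeq] at h0
  have hj₀ : j₀ ∈ (Finset.univ.filter fun j => c ⬝ᵥ q j = c ⬝ᵥ q j₀ : Finset (Fin (K + 1))) :=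
    Finset.mem_filter.2 ⟨Finset.mem_univ _, rfl⟩
  have hSmax : ∀ j ∈ (Finset.univ.filter fun j => c ⬝ᵥ q j = c ⬝ᵥ q j₀ : Finset (Fin (K + 1))),
      ∀ k, c ⬝ᵥ q k ≤ c ⬝ᵥ q j := fun j hj k => by
    rw [(Finset.mem_filter.1 hj).2]
    exact hmax k (Finset.mem_univ _)
  have hαex : ∀ j, ∃ α : ℝ, j ∈ (Finset.univ.filter fun j => c ⬝ᵥ q j = c ⬝ᵥ q j₀ : Finset (Fin (K + 1))) →
      q j - q j₀ = α • Jdir n := by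
    intro j
    by_cases hj : j ∈ (Finset.univ.filter fun j => c ⬝ᵥ q j = c ⬝ᵥ q j₀ : Finset (Fin (K + 1)))
    · obtain ⟨α, hα⟩ := hthin j j₀ (hSmax j hj) (hSmax j₀ hj₀)
      exact ⟨α, fun _ => hα⟩
    · exact ⟨0, fun h => (hj h).elim⟩
  choose α hα using hαex
  have hq : ∀ j ∈ (Finset.univ.filter fun j => c ⬝ᵥ q j = c ⬝ᵥ q j₀ : Finset (Fin (K + 1))),
      q j = q j₀ + α j • Jdir n := fun j hj => by
    rw [← hα j hj, add_sub_cancel]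
  obtain ⟨a, -, b, -, hpair⟩ := convexHull_collinear_pair q (Jdir n) _ ⟨j₀, hj₀⟩ α (q j₀) hq
  rw [hpair] at h0
  have h2 := h0.image_linearMap (LinearMap.funLeft ℝ ℝ (fun ij : Fin m × Fin m => (ρ ij.1, ρ ij.2)))
  rw [Set.image_add, funLeft_image_cor_blockFace β hB hρ, LinearMap.image_convexHull] at h2
  refine ⟨fun i => if i = 0 then LinearMap.funLeft ℝ ℝ (fun ij : Fin m × Fin m => (ρ ij.1, ρ ij.2)) (q a)
    else LinearMap.funLeft ℝ ℝ (fun ij : Fin m × Fin m => (ρ ij.1, ρ ij.2)) (q b), ?_⟩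
  convert h2 using 3
  ext y
  constructor
  · rintro ⟨i, rfl⟩
    by_cases hi : i = 0
    · exact ⟨q a, Or.inl rfl, by simp [hi]⟩
    · exact ⟨q b, Or.inr rfl, by simp [hi]⟩
  · rintro ⟨x, hx, rfl⟩
    rcases hx with rfl | hx
    · exact ⟨0, by simp⟩
    · rw [Set.mem_singleton_iff] at hx
      subst hx
      exact ⟨1, by simp⟩

/-- [40 §1b, verbatim] ★ … hence the count (PROP A at `K = 2`). -/
theorem exposedFibreDecided_holds : ExposedFibreDecided := by
  intro n m β ρ hρ K q r hE hEF
  obtain ⟨q', hq'⟩ := exposedFibreRung_holds n m β ρ hρ K q r hE hEF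
  have h := corPolytopeGraph_top_add_hull_three_pow_le q' (by norm_num) hq'
  calc 3 ^ m ≤ 2 * (r + 1) * 2 ^ m := h
    _ = (r + 1) * 2 ^ (m + 1) := by ring

/-! ### §11b (new) the generic admissible separator and the rung for zonotopes -/

/-- a linear functional on `ι → ℝ` is a dot product. -/
theorem dual_eq_dotProduct {ι : Type} [Fintype ι] [DecidableEq ι] (f : Module.Dual ℝ (ι → ℝ)) (x : ι → ℝ) :
    f x = (fun i => f (Pi.single i 1)) ⬝ᵥ x := by
  have hx : x = ∑ i, x i • (Pi.single i (1 : ℝ) : ι → ℝ) := by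
    ext j
    simp [Finset.sum_apply, Pi.single_apply]
  conv_lhs => rw [hx]
  simp only [map_sum, map_smul, smul_eq_mul, dotProduct]
  exact Finset.sum_congr rfl fun i _ => mul_comm _ _

/-- a zone outside `W_β` (not a symmetric block-constant matrix) is SEEN by a functional vanishing on all block-constant
vertices of `COR(K_n)` (finite-dimensional duality + ✓ `blockConstSym_of_mem_span`). -/
theorem exists_sep (β : Fin n → Fin m) {g : Fin n × Fin n → ℝ} (hg : ¬ BlockConstSymGen β g) :
    ∃ u : Fin n × Fin n → ℝ, (∀ b, BlockConst β b → u ⬝ᵥ corVec (⊤ : SimpleGraph (Fin n)) b = 0) ∧ u ⬝ᵥ g ≠ 0 := by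
  classical
  set V : Submodule ℝ (Fin n × Fin n → ℝ) := Submodule.span ℝ (Set.range fun b :
    {b : Fin n → Bool // ∀ p q, β p = β q → b p = b q} => corVec (⊤ : SimpleGraph (Fin n)) b.1) with hV
  have hgV : g ∉ V := fun h => hg (blockConstSym_of_mem_span β h)
  obtain ⟨f, hf, hmap⟩ := Submodule.exists_dual_map_eq_bot_of_notMem hgV inferInstance
  refine ⟨fun i => f (Pi.single i 1), fun b hb => ?_, ?_⟩
  · rw [← dual_eq_dotProduct]
    have hmem : corVec (⊤ : SimpleGraph (Fin n)) b ∈ V := Submodule.subset_span ⟨⟨b, hb⟩, rfl⟩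
    have : f (corVec (⊤ : SimpleGraph (Fin n)) b) ∈ V.map f := Submodule.mem_map_of_mem hmem
    rw [hmap] at this
    simpa using this
  · rwa [← dual_eq_dotProduct]

/-- dot product with a finite linear combination. -/
theorem sum_smul_dotProduct' {ι K : Type} [Fintype ι] [Fintype K] (ε : K → ℝ) (u : K → ι → ℝ) (x : ι → ℝ) :
    (∑ t, ε t • u t) ⬝ᵥ x = ∑ t, ε t * (u t ⬝ᵥ x) := by
  simp only [dotProduct, Finset.sum_apply, Pi.smul_apply, smul_eq_mul, Finset.sum_mul, Finset.mul_sum]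
  rw [Finset.sum_comm]
  exact Finset.sum_congr rfl fun t _ => Finset.sum_congr rfl fun i _ => by ring

/-- ★ GENERIC ADMISSIBLE SEPARATOR: for every finite family of zones there is an admissible direction that is nonzero on
every zone outside `W_β`. -/
theorem exists_admissible_sep (β : Fin n → Fin m) {M : ℕ} (gen : Fin M → (Fin n × Fin n → ℝ)) :
    ∃ c : Fin n × Fin n → ℝ, Admissible β c ∧ ∀ i, ¬ BlockConstSymGen β (gen i) → c ⬝ᵥ gen i ≠ 0 := by
  classical
  obtain ⟨c₀, hc₀⟩ := admissible_blockDir (n := n) (m := m) β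
  -- one separator per bad zone
  have hu : ∀ i : Fin M, ∃ u : Fin n × Fin n → ℝ,
      (∀ b, BlockConst β b → u ⬝ᵥ corVec (⊤ : SimpleGraph (Fin n)) b = 0) ∧
      (¬ BlockConstSymGen β (gen i) → u ⬝ᵥ gen i ≠ 0) := by
    intro i
    by_cases hi : BlockConstSymGen β (gen i)
    · exact ⟨0, fun b _ => by simp, fun h => (h hi).elim⟩
    · obtain ⟨u, hu1, hu2⟩ := exists_sep β hi
      exact ⟨u, hu1, fun _ => hu2⟩
  choose u hu0 husep using hu
  -- a generic combination `D` of the separators sees every bad zone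
  obtain ⟨ε, hε⟩ := exists_generic_comb (K := Fin M) (Finset.univ : Finset (Fin M)) (fun t i => u t ⬝ᵥ gen i)
  set D : Fin n × Fin n → ℝ := ∑ t, ε t • u t with hD
  have hD0 : ∀ b, BlockConst β b → D ⬝ᵥ corVec (⊤ : SimpleGraph (Fin n)) b = 0 := fun b hb => by
    rw [hD, sum_smul_dotProduct']
    exact Finset.sum_eq_zero fun t _ => by rw [hu0 t b hb, mul_zero]
  have hDsep : ∀ i, ¬ BlockConstSymGen β (gen i) → D ⬝ᵥ gen i ≠ 0 := fun i hi => by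
    rw [hD, sum_smul_dotProduct']
    exact hε i (Finset.mem_univ _) ⟨i, husep i hi⟩
  -- a large multiple of `c₀` plus `D`: admissible, and still separating for a generic multiplier
  let bad : Finset (Fin M) := Finset.univ.filter fun i => ¬ BlockConstSymGen β (gen i)
  let prs : Finset (ℝ × ℝ) := bad.image fun i => (c₀ ⬝ᵥ gen i, D ⬝ᵥ gen i)
  have hprs : ∀ p ∈ prs, p.1 ≠ 0 ∨ p.2 ≠ 0 := by
    intro p hp
    obtain ⟨i, hi, rfl⟩ := Finset.mem_image.1 hp
    exact Or.inr (hDsep i (Finset.mem_filter.1 hi).2)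
  let nb : Finset (Fin n → Bool) := Finset.univ.filter fun b => ¬ BlockConst β b
  obtain ⟨L, hL, hLsep⟩ := exists_large_avoid prs hprs
    (∑ b ∈ nb, |D ⬝ᵥ corVec (⊤ : SimpleGraph (Fin n)) b| / (-(c₀ ⬝ᵥ corVec (⊤ : SimpleGraph (Fin n)) b)))
  refine ⟨L • c₀ + D, ⟨fun b hb => ?_, fun b hb => ?_⟩, fun i hi => ?_⟩
  · rw [add_dotProduct, smul_dotProduct, hc₀.1 b hb, hD0 b hb, smul_zero, add_zero]
  · have hneg : c₀ ⬝ᵥ corVec (⊤ : SimpleGraph (Fin n)) b < 0 := hc₀.2 b hb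
    have hbmem : b ∈ nb := Finset.mem_filter.2 ⟨Finset.mem_univ _, hb⟩
    have hle : |D ⬝ᵥ corVec (⊤ : SimpleGraph (Fin n)) b| / (-(c₀ ⬝ᵥ corVec (⊤ : SimpleGraph (Fin n)) b)) ≤
        ∑ b ∈ nb, |D ⬝ᵥ corVec (⊤ : SimpleGraph (Fin n)) b| / (-(c₀ ⬝ᵥ corVec (⊤ : SimpleGraph (Fin n)) b)) :=
      Finset.single_le_sum (f := fun b => |D ⬝ᵥ corVec (⊤ : SimpleGraph (Fin n)) b| /
        (-(c₀ ⬝ᵥ corVec (⊤ : SimpleGraph (Fin n)) b)))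
        (fun b' hb' => div_nonneg (abs_nonneg _) (by
          have := hc₀.2 b' (Finset.mem_filter.1 hb').2; linarith)) hbmem
    have hLgt : |D ⬝ᵥ corVec (⊤ : SimpleGraph (Fin n)) b| / (-(c₀ ⬝ᵥ corVec (⊤ : SimpleGraph (Fin n)) b)) < L :=
      lt_of_le_of_lt hle hL
    rw [add_dotProduct, smul_dotProduct, smul_eq_mul]
    have hpos : 0 < -(c₀ ⬝ᵥ corVec (⊤ : SimpleGraph (Fin n)) b) := by linarith
    have h1 : |D ⬝ᵥ corVec (⊤ : SimpleGraph (Fin n)) b| < L * (-(c₀ ⬝ᵥ corVec (⊤ : SimpleGraph (Fin n)) b)) := by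
      rwa [div_lt_iff₀ hpos] at hLgt
    have h2 := le_abs_self (D ⬝ᵥ corVec (⊤ : SimpleGraph (Fin n)) b)
    nlinarith
  · have hmem : (c₀ ⬝ᵥ gen i, D ⬝ᵥ gen i) ∈ prs :=
      Finset.mem_image.2 ⟨i, Finset.mem_filter.2 ⟨Finset.mem_univ _, hi⟩, rfl⟩
    have := hLsep _ hmem
    rwa [add_dotProduct, smul_dotProduct, smul_eq_mul, mul_comm] 

/-- the value of `c` on a subset sum. -/
theorem dot_subsetSum {M : ℕ} (c : Fin n × Fin n → ℝ) (gen : Fin M → (Fin n × Fin n → ℝ)) (w : Fin n × Fin n → ℝ)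
    (S : Finset (Fin M)) : c ⬝ᵥ subsetSum gen w S = c ⬝ᵥ w + ∑ i ∈ S, c ⬝ᵥ gen i := by
  simp [subsetSum, dotProduct_add, dotProduct_sum]

/-- EXCHANGE: at a maximising subset sum, zones inside have `c·g ≥ 0` and zones outside have `c·g ≤ 0`. -/
theorem maximiser_signs {M : ℕ} (c : Fin n × Fin n → ℝ) (gen : Fin M → (Fin n × Fin n → ℝ)) (w : Fin n × Fin n → ℝ)
    (S : Finset (Fin M)) (hmax : ∀ T, c ⬝ᵥ subsetSum gen w T ≤ c ⬝ᵥ subsetSum gen w S) (i : Fin M) :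
    (i ∈ S → 0 ≤ c ⬝ᵥ gen i) ∧ (i ∉ S → c ⬝ᵥ gen i ≤ 0) := by
  classical
  constructor
  · intro hi
    have h := hmax (S.erase i)
    rw [dot_subsetSum, dot_subsetSum, Finset.sum_erase_eq_sub hi] at h
    linarith
  · intro hi
    have h := hmax (insert i S)
    rw [dot_subsetSum, dot_subsetSum, Finset.sum_insert hi] at h
    linarith

/-- two maximising subset sums differ by a multiple of `J` once every `c`-invisible zone is a multiple of `J`. -/
theorem maximisers_differ_by_J {M : ℕ} (c : Fin n × Fin n → ℝ) (gen : Fin M → (Fin n × Fin n → ℝ))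
    (w : Fin n × Fin n → ℝ) (hJ : ∀ i, c ⬝ᵥ gen i = 0 → ∃ α : ℝ, gen i = α • Jdir n)
    (S S' : Finset (Fin M)) (hS : ∀ T, c ⬝ᵥ subsetSum gen w T ≤ c ⬝ᵥ subsetSum gen w S)
    (hS' : ∀ T, c ⬝ᵥ subsetSum gen w T ≤ c ⬝ᵥ subsetSum gen w S') :
    ∃ α : ℝ, subsetSum gen w S - subsetSum gen w S' = α • Jdir n := by
  classical
  have hzero : ∀ i ∈ S \ S' ∪ S' \ S, c ⬝ᵥ gen i = 0 := by
    intro i hi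
    rcases Finset.mem_union.1 hi with h | h
    · obtain ⟨h1, h2⟩ := Finset.mem_sdiff.1 h
      exact le_antisymm ((maximiser_signs c gen w S' hS' i).2 h2) ((maximiser_signs c gen w S hS i).1 h1)
    · obtain ⟨h1, h2⟩ := Finset.mem_sdiff.1 h
      exact le_antisymm ((maximiser_signs c gen w S hS i).2 h2) ((maximiser_signs c gen w S' hS' i).1 h1)
  have hαex : ∀ i, ∃ α : ℝ, i ∈ S \ S' ∪ S' \ S → gen i = α • Jdir n := by
    intro i
    by_cases hi : i ∈ S \ S' ∪ S' \ S
    · obtain ⟨α, hα⟩ := hJ i (hzero i hi)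
      exact ⟨α, fun _ => hα⟩
    · exact ⟨0, fun h => (hi h).elim⟩
  choose α hα using hαex
  refine ⟨∑ i ∈ S \ S', α i - ∑ i ∈ S' \ S, α i, ?_⟩
  have hdiff : subsetSum gen w S - subsetSum gen w S' = ∑ i ∈ S \ S', gen i - ∑ i ∈ S' \ S, gen i := by
    rw [Finset.sum_sdiff_sub_sum_sdiff (s₂ := S) (s₁ := S') (f := gen)]
    simp only [subsetSum]
    abel
  rw [hdiff, sub_smul, Finset.sum_smul, Finset.sum_smul]
  congr 1
  · exact Finset.sum_congr rfl fun i hi => hα i (Finset.mem_union.2 (Or.inl hi))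
  · exact Finset.sum_congr rfl fun i hi => hα i (Finset.mem_union.2 (Or.inr hi))

/-- ★★ P-R1b FIRST LINK IN KERNEL: the one-cut rung for zonotopes — `ZonoGenBlindAtDecided` HOLDS.  Hence `ClassZ ⇐ CovZonoHard`
outright (`classZ_of_covZonoHard`), (Z1) of the residual spec is unconditional (`zonoEnemy_covers'`), and `FewZonesLawAt` is
reduced to `EquipartitionAvoidance` alone. -/
theorem zonoGenBlindAtDecided_holds : ZonoGenBlindAtDecided := by
  classical
  intro h m' K q r hZ hEF
  obtain ⟨β, ρ, hρ, M, gen, w, hhull, hbl⟩ := hZ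
  -- reindex the subset-sum family by `Fin (K' + 1)`
  obtain ⟨K', ⟨e⟩⟩ : ∃ K', Nonempty (Finset (Fin M) ≃ Fin (K' + 1)) := by
    refine ⟨Fintype.card (Finset (Fin M)) - 1, ⟨(Fintype.equivFin _).trans (finCongr ?_)⟩⟩
    have : 0 < Fintype.card (Finset (Fin M)) := Fintype.card_pos
    omega
  have hq : Set.range (subsetSum gen w ∘ e.symm) = Set.range (subsetSum gen w) :=
    Function.Surjective.range_comp e.symm.surjective _
  have hEF' : HasEFOfSize (corPolytopeGraph (⊤ : SimpleGraph (Fin h)) +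
      convexHull ℝ (Set.range (subsetSum gen w ∘ e.symm))) r := by
    rw [hq, ← hhull]; exact hEF
  -- the generic admissible separator
  obtain ⟨c, hc, hsep⟩ := exists_admissible_sep (n := h) (m := m') β gen
  have hJ : ∀ i, c ⬝ᵥ gen i = 0 → ∃ α : ℝ, gen i = α • Jdir h := by
    intro i hi
    by_cases hb : BlockConstSymGen β (gen i)
    · exact hbl i hb
    · exact absurd hi (hsep i hb)
  have hE : ExposedFibreBlind β (subsetSum gen w ∘ e.symm) := by
    refine ⟨c, hc, fun j j' hj hj' => ?_⟩
    have hS : ∀ T, c ⬝ᵥ subsetSum gen w T ≤ c ⬝ᵥ subsetSum gen w (e.symm j) := fun T => by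
      simpa using hj (e T)
    have hS' : ∀ T, c ⬝ᵥ subsetSum gen w T ≤ c ⬝ᵥ subsetSum gen w (e.symm j') := fun T => by
      simpa using hj' (e T)
    exact maximisers_differ_by_J c gen w hJ _ _ hS hS'
  have hcount := exposedFibreDecided_holds h m' β ρ hρ K' (subsetSum gen w ∘ e.symm) r hE hEF'
  -- `3^m' ≤ (r+1)·2^(m'+1)` ⇒ `(3/2)^(m'-1) ≤ 2(r+1)`
  have hR : (3 : ℝ) ^ m' ≤ (r + 1) * 2 ^ (m' + 1) := by exact_mod_cast hcount
  have h2pos : (0 : ℝ) < 2 ^ m' := by positivity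
  have hmain : (3 / 2 : ℝ) ^ m' ≤ 2 * (r + 1) := by
    rw [div_pow, div_le_iff₀ h2pos]
    calc (3 : ℝ) ^ m' ≤ (r + 1) * 2 ^ (m' + 1) := hR
      _ = 2 * (r + 1) * 2 ^ m' := by ring
  calc (3 / 2 : ℝ) ^ (m' - 1) ≤ (3 / 2) ^ m' := pow_le_pow_right₀ (by norm_num) (Nat.sub_le _ _)
    _ ≤ 2 * (r + 1) := hmain

/-- ★ COROLLARY: class Z is reduced to `CovZonoHard` OUTRIGHT (no rung hypothesis left). -/
theorem classZ_of_covZonoHard (hCov : CovZonoHard) : ClassZ :=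
  classZReduction hCov zonoGenBlindAtDecided_holds

/-- ★ COROLLARY: (Z1) of the residual spec, unconditionally — every zonotopal enemy COVERS the reduction level. -/
theorem zonoEnemy_covers' (C h : ℕ) {M : ℕ} (gen : Fin M → (Fin h × Fin h → ℝ)) (w : Fin h × Fin h → ℝ) (r : ℕ)
    (hE : ZonoEnemy C h gen w r) : Covers h (2 * (Nat.log 2 h + C) ^ C + 4) gen :=
  zonoEnemy_covers zonoGenBlindAtDecided_holds C h gen w r hE

end PastedFromValIdea40


/-! ## 12. THE FEW-ZONES LAW IN KERNEL — `EquipartitionAvoidance` replaced by a ONE-BLOCK avoidance count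

To feed `zonoGenBlindAtDecided_holds` one needs a level-`m'` block map `β` (with a section) capturing NO zone off `ℝJ`.
Instead of the sharp equipartition double count (38/40's `EquipartitionAvoidance`, threshold `C(m't,t)/m'` zones) we use ONE
block: `B = {x₀} ∪ R` with `R` a `(t-1)`-subset of `[h] ∖ {x₀}`, the other `m'-1` blocks arbitrary of size `≥ t`.  A captured
zone `g ∉ ℝJ` has a row class `A ∌` everything (✓ `captureIffRefines`); if `|A(x₀)| ≤ h - t` then `B ⊆ A(x₀)` costs `R` one of
`≤ C(h-t-1, t-1)` positions; if `|A(x₀)| > h - t` the complement (nonempty, `< t` points) cannot be a union of blocks of size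
`≥ t`.  Union bound: `M·C(h-t-1,t-1) < C(h-1,t-1)` suffices — threshold `C(h-1,t-1)/C(h-t-1,t-1) ≥ (1 + t/(h-t))^{t-1}
≈ e^{t²/h} = e^{h/m'²}` zones at `t = h/m'`, i.e. STILL `2^{h^{1-o(1)}}` at `m' = polylog h`: the headline law survives with a
weaker constant in the exponent, and is now a KERNEL THEOREM (`fewZonesLaw_oneBlock`). -/

section FewZones
open Summit.ValiantsHypothesis.ValiantsHypothesis.Theorems.FifoMatching.LocatedFaceExposure

/-- all rows equal (to row `x₀`) and symmetric ⇒ a multiple of `J`. -/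
theorem eq_smul_Jdir_of_sameRow {g : Fin n × Fin n → ℝ} (hsym : ∀ p q, g (p, q) = g (q, p)) (x₀ : Fin n)
    (hall : ∀ q, SameRow g x₀ q) : ∃ α : ℝ, g = α • Jdir n := by
  refine ⟨g (x₀, x₀), funext fun pq => ?_⟩
  obtain ⟨p, q⟩ := pq
  simp only [Pi.smul_apply, Jdir, smul_eq_mul, mul_one]
  rw [← hall p q, hsym x₀ q, ← hall q x₀]

/-- ★ ONE-BLOCK AVOIDANCE: `M` zones, level `m' ≥ 2`, block size `t ≥ 1`, `m'·t ≤ h`, and `M·C(h-t-1,t-1) < C(h-1,t-1)` ⇒ a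
level-`m'` block map with a section capturing no zone off `ℝJ`. -/
theorem exists_oneBlock_avoiding (h m' t M : ℕ) (hm : 2 ≤ m') (ht : 1 ≤ t) (hh : m' * t ≤ h)
    (gen : Fin M → (Fin h × Fin h → ℝ))
    (hcount : M * Nat.choose (h - t - 1) (t - 1) < Nat.choose (h - 1) (t - 1)) :
    ∃ (β : Fin h → Fin m') (ρ : Fin m' → Fin h), (∀ j, β (ρ j) = j) ∧
      ∀ i, BlockConstSymGen β (gen i) → ∃ α : ℝ, gen i = α • Jdir h := by
  classical
  obtain ⟨m₂, rfl⟩ : ∃ m₂, m' = m₂ + 2 := ⟨m' - 2, by omega⟩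
  have ht0 : 0 < t := ht
  have hh' : m₂ * t + 2 * t ≤ h := by rw [add_mul] at hh; omega
  let x₀ : Fin h := ⟨0, by omega⟩
  -- row classes of `x₀`
  let A : Fin M → Finset (Fin h) := fun i => Finset.univ.filter fun q => SameRow (gen i) x₀ q
  have hx₀A : ∀ i, x₀ ∈ A i := fun i => Finset.mem_filter.2 ⟨Finset.mem_univ _, fun _ => rfl⟩
  -- bad positions for `R`
  let bad : Fin M → Finset (Finset (Fin h)) := fun i =>
    if (A i).card ≤ h - t then Finset.powersetCard (t - 1) ((A i).erase x₀) else ∅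
  have hbad_card : ∀ i, (bad i).card ≤ Nat.choose (h - t - 1) (t - 1) := by
    intro i
    simp only [bad]
    split_ifs with hsm
    · rw [Finset.card_powersetCard, Finset.card_erase_of_mem (hx₀A i)]
      exact Nat.choose_le_choose _ (by omega)
    · simp
  have hU : (Finset.univ.biUnion bad).card ≤ M * Nat.choose (h - t - 1) (t - 1) :=
    calc (Finset.univ.biUnion bad).card ≤ ∑ i, (bad i).card := Finset.card_biUnion_le
      _ ≤ ∑ _i : Fin M, Nat.choose (h - t - 1) (t - 1) := Finset.sum_le_sum fun i _ => hbad_card i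
      _ = M * Nat.choose (h - t - 1) (t - 1) := by simp
  have hP : (Finset.powersetCard (t - 1) (Finset.univ.erase x₀)).card = Nat.choose (h - 1) (t - 1) := by
    rw [Finset.card_powersetCard, Finset.card_erase_of_mem (Finset.mem_univ _), Finset.card_univ, Fintype.card_fin]
  obtain ⟨R, hRP, hRU⟩ : ∃ R ∈ Finset.powersetCard (t - 1) (Finset.univ.erase x₀), R ∉ Finset.univ.biUnion bad := by
    by_contra hcon
    push Not at hcon
    have := Finset.card_le_card (show Finset.powersetCard (t - 1) (Finset.univ.erase x₀) ⊆ Finset.univ.biUnion bad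
      from fun S hS => hcon S hS)
    omega
  obtain ⟨hRsub, hRcard⟩ := Finset.mem_powersetCard.1 hRP
  have hx₀R : x₀ ∉ R := fun hx => (Finset.mem_erase.1 (hRsub hx)).1 rfl
  have hRgood : ∀ i, R ∉ bad i := fun i hi => hRU (Finset.mem_biUnion.2 ⟨i, Finset.mem_univ _, hi⟩)
  -- the block `B` and its complement `C`
  let B : Finset (Fin h) := insert x₀ R
  have hx₀B : x₀ ∈ B := Finset.mem_insert_self _ _
  have hBcard : B.card = t := by
    simp only [B]
    rw [Finset.card_insert_of_notMem hx₀R]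
    omega
  let C : Finset (Fin h) := Finset.univ \ B
  have hCcard : C.card = h - t := by
    simp only [C]
    rw [Finset.card_univ_sdiff, Fintype.card_fin, hBcard]
  have memC : ∀ {q : Fin h}, q ∉ B → q ∈ C := fun hq => Finset.mem_sdiff.2 ⟨Finset.mem_univ _, hq⟩
  have notB_of_memC : ∀ {q : Fin h}, q ∈ C → q ∉ B := fun hq => (Finset.mem_sdiff.1 hq).2
  obtain ⟨e⟩ : Nonempty ({q // q ∈ C} ≃ Fin (h - t)) :=
    ⟨Fintype.equivFinOfCardEq (by rw [Fintype.card_coe, hCcard])⟩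
  -- labels, the block map, its section
  obtain ⟨lab, hlab⟩ : ∃ lab : ℕ → Fin (m₂ + 2), ∀ i, (lab i).val = 1 + min (i / t) m₂ :=
    ⟨fun i => ⟨1 + min (i / t) m₂, by have := min_le_right (i / t) m₂; omega⟩, fun _ => rfl⟩
  obtain ⟨β, hβB, hβC⟩ : ∃ β : Fin h → Fin (m₂ + 2), (∀ q, q ∈ B → β q = ⟨0, by omega⟩) ∧
      ∀ q (hq : q ∉ B), β q = lab (e ⟨q, memC hq⟩).val :=
    ⟨fun q => if hq : q ∈ B then ⟨0, by omega⟩ else lab (e ⟨q, memC hq⟩).val,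
      fun q hq => dif_pos hq, fun q hq => dif_neg hq⟩
  have hρidx : ∀ j : Fin (m₂ + 2), j.val ≠ 0 → (j.val - 1) * t < h - t := fun j hj => by
    have := Nat.mul_le_mul_right t (show j.val - 1 ≤ m₂ by omega)
    omega
  obtain ⟨ρ, hρ0, hρ1⟩ : ∃ ρ : Fin (m₂ + 2) → Fin h, (∀ j, j.val = 0 → ρ j = x₀) ∧
      ∀ j (hj : j.val ≠ 0), ρ j = (e.symm ⟨(j.val - 1) * t, hρidx j hj⟩).val :=
    ⟨fun j => if hj : j.val = 0 then x₀ else (e.symm ⟨(j.val - 1) * t, hρidx j hj⟩).val,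
      fun j hj => dif_pos hj, fun j hj => dif_neg hj⟩
  -- the label of the `e`-index `k + (j-1)·t` is `j`
  have hlab_idx : ∀ (j : Fin (m₂ + 2)) (k : ℕ), j.val ≠ 0 → k < t → lab (k + (j.val - 1) * t) = j := by
    intro j k hj hk
    apply Fin.ext
    rw [hlab, Nat.add_mul_div_right _ _ ht0, Nat.div_eq_of_lt hk, zero_add, min_eq_left (by omega : j.val - 1 ≤ m₂)]
    omega
  have hβe : ∀ (idx : Fin (h - t)), β (e.symm idx).val = lab idx.val := by
    intro idx
    have hnot : (e.symm idx).val ∉ B := notB_of_memC (e.symm idx).2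
    rw [hβC _ hnot]
    congr 2
    rw [Subtype.coe_eta, Equiv.apply_symm_apply]
  refine ⟨β, ρ, fun j => ?_, fun i hcap => ?_⟩
  · -- section
    by_cases hj : j.val = 0
    · rw [hρ0 j hj, hβB x₀ hx₀B]
      exact Fin.ext (by simp [hj])
    · rw [hρ1 j hj, hβe]
      have := hlab_idx j 0 hj ht0
      rwa [zero_add] at this
  · -- no zone off `ℝJ` is captured
    have hsym := hcap.1
    have href : ∀ p p', β p = β p' → SameRow (gen i) p p' := (captureIffRefines h (m₂ + 2) β (gen i) hsym).1 hcap
    by_cases hall : ∀ q, SameRow (gen i) x₀ q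
    · exact eq_smul_Jdir_of_sameRow hsym x₀ hall
    exfalso
    push Not at hall
    obtain ⟨q₀, hq₀⟩ := hall
    by_cases hsm : (A i).card ≤ h - t
    · -- small class: `R ⊆ A(x₀) ∖ {x₀}` is a bad position
      refine hRgood i ?_
      have hbad : bad i = Finset.powersetCard (t - 1) ((A i).erase x₀) := if_pos hsm
      rw [hbad]
      refine Finset.mem_powersetCard.2 ⟨fun p hp => ?_, hRcard⟩
      have hpB : p ∈ B := Finset.mem_insert_of_mem hp
      have hpx : p ≠ x₀ := fun h0 => hx₀R (h0 ▸ hp)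
      refine Finset.mem_erase.2 ⟨hpx, Finset.mem_filter.2 ⟨Finset.mem_univ _, href x₀ p ?_⟩⟩
      rw [hβB x₀ hx₀B, hβB p hpB]
    · -- big class: the block of `q₀` has `≥ t` points outside `A(x₀)`, which has `< t` points outside
      push Not at hsm
      have hq₀B : q₀ ∉ B := fun hq => hq₀ (href x₀ q₀ (by rw [hβB x₀ hx₀B, hβB q₀ hq]))
      have hj : (β q₀).val ≠ 0 := by
        rw [hβC q₀ hq₀B, hlab]
        exact (Nat.add_pos_left Nat.one_pos _).ne'
      have hidx : ∀ k : Fin t, k.val + ((β q₀).val - 1) * t < h - t := fun k => by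
        have := hρidx (β q₀) hj
        have := Nat.mul_le_mul_right t (show (β q₀).val - 1 ≤ m₂ by omega)
        omega
      obtain ⟨pk, hpk⟩ : ∃ pk : Fin t → Fin h, ∀ k, pk k = (e.symm ⟨k.val + ((β q₀).val - 1) * t, hidx k⟩).val :=
        ⟨fun k => (e.symm ⟨k.val + ((β q₀).val - 1) * t, hidx k⟩).val, fun _ => rfl⟩
      have hpk_inj : Function.Injective pk := by
        intro k₁ k₂ hk
        rw [hpk, hpk] at hk
        have h1 := e.symm.injective (Subtype.val_injective hk)
        rw [Fin.mk.injEq] at h1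
        exact Fin.ext (by omega)
      have hβpk : ∀ k, β (pk k) = β q₀ := fun k => by
        rw [hpk, hβe]
        exact hlab_idx (β q₀) k.val hj k.isLt
      have hpk_notA : ∀ k, pk k ∉ A i := fun k hk => hq₀ (by
        have h1 : SameRow (gen i) x₀ (pk k) := (Finset.mem_filter.1 hk).2
        have h2 : SameRow (gen i) q₀ (pk k) := href q₀ (pk k) (hβpk k).symm
        exact fun q => (h1 q).trans (h2 q).symm)
      have hcard_le : t ≤ (Finset.univ \ A i).card :=
        calc t = (Finset.univ.image pk).card := by
              rw [Finset.card_image_of_injective _ hpk_inj, Finset.card_univ, Fintype.card_fin]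
          _ ≤ (Finset.univ \ A i).card := Finset.card_le_card fun p hp => by
              obtain ⟨k, -, rfl⟩ := Finset.mem_image.1 hp
              exact Finset.mem_sdiff.2 ⟨Finset.mem_univ _, hpk_notA k⟩
      rw [Finset.card_univ_sdiff, Fintype.card_fin] at hcard_le
      have hAle : (A i).card ≤ h := by simpa using (A i).card_le_univ
      omega

/-- ★ THE FEW-ZONES LAW, one-block form (statement). -/
def FewZonesLawOneBlock : Prop :=
  ∀ (h m' t M : ℕ) (gen : Fin M → (Fin h × Fin h → ℝ)) (w : Fin h × Fin h → ℝ) (r : ℕ),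
    2 ≤ m' → 1 ≤ t → m' * t ≤ h → M * Nat.choose (h - t - 1) (t - 1) < Nat.choose (h - 1) (t - 1) →
    HasEFOfSize (corPolytopeGraph (⊤ : SimpleGraph (Fin h)) + convexHull ℝ (Set.range (subsetSum gen w))) r →
      (3 / 2 : ℝ) ^ (m' - 1) ≤ 2 * (r + 1)

/-- ★★ THE FEW-ZONES LAW IS A KERNEL THEOREM: every zonotopal passenger `Z = w + Σ [0,1]·gen i` with
`M·C(h-t-1,t-1) < C(h-1,t-1)` zones (any `t ≥ 1`, `m' ≥ 2`, `m'·t ≤ h`) obeys `(3/2)^{m'-1} ≤ 2(r+1)` whenever `COR(K_h) + Z` has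
an extended formulation of size `r` — `exists_oneBlock_avoiding` + `zonoGenBlindAtDecided_holds`.  At `m' = 2(log₂ h + C)^C + 4`,
`t = h / m'` this DECIDES (in the crux's shape `2^{(log₂ h + C)^C} < r`, via the arithmetic of `lt_of_not_covers`) every zonotope
with `≤ 2^{h^{1-o(1)}}` zones. -/
theorem fewZonesLaw_oneBlock : FewZonesLawOneBlock := by
  classical
  intro h m' t M gen w r hm ht hh hcount hEF
  obtain ⟨β, ρ, hρ, hZ⟩ := exists_oneBlock_avoiding h m' t M hm ht hh gen hcount
  obtain ⟨K', ⟨e⟩⟩ : ∃ K', Nonempty (Finset (Fin M) ≃ Fin (K' + 1)) := by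
    refine ⟨Fintype.card (Finset (Fin M)) - 1, ⟨(Fintype.equivFin _).trans (finCongr ?_)⟩⟩
    have : 0 < Fintype.card (Finset (Fin M)) := Fintype.card_pos
    omega
  have hq : Set.range (subsetSum gen w ∘ e.symm) = Set.range (subsetSum gen w) :=
    Function.Surjective.range_comp e.symm.surjective _
  refine zonoGenBlindAtDecided_holds h m' K' (subsetSum gen w ∘ e.symm) r
    ⟨β, ρ, hρ, M, gen, w, by rw [hq], hZ⟩ ?_
  rw [hq]
  exact hEF

/-- ★ COROLLARY — the few-zones law IN THE CRUX'S SHAPE: at level `m' = 2(log₂ h + C)^C + 4`, a zonotopal passenger with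
`M·C(h-t-1,t-1) < C(h-1,t-1)` zones (some `t ≥ 1`, `m'·t ≤ h`) is DECIDED — `2^{(log₂ h + C)^C} < r` for every extended formulation
of `COR(K_h) + Z` of size `r`. -/
theorem fewZones_decided (C h t M : ℕ) (gen : Fin M → (Fin h × Fin h → ℝ)) (w : Fin h × Fin h → ℝ) (r : ℕ) (ht : 1 ≤ t)
    (hh : (2 * (Nat.log 2 h + C) ^ C + 4) * t ≤ h)
    (hcount : M * Nat.choose (h - t - 1) (t - 1) < Nat.choose (h - 1) (t - 1))
    (hR : HasEFOfSize (corPolytopeGraph (⊤ : SimpleGraph (Fin h)) + convexHull ℝ (Set.range (subsetSum gen w))) r) :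
    2 ^ ((Nat.log 2 h + C) ^ C) < r := by
  set L := (Nat.log 2 h + C) ^ C with hLdef
  have hdec := fewZonesLaw_oneBlock h (2 * L + 4) t M gen w r (by omega) ht hh hcount hR
  have hm : 2 * L + 4 - 1 = 2 * L + 3 := by omega
  rw [hm] at hdec
  have hL : 1 ≤ L := one_le_L h C
  have h1 : (2 : ℝ) ≤ 2 ^ L := by
    calc (2 : ℝ) = 2 ^ 1 := by norm_num
      _ ≤ 2 ^ L := pow_le_pow_right₀ (by norm_num) hL
  have h2 : (2 : ℝ) ^ L ≤ (9 / 4) ^ L := pow_le_pow_left₀ (by norm_num) (by norm_num) L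
  have key : (3 / 2 : ℝ) ^ (2 * L + 3) = (9 / 4) ^ L * (27 / 8) := by
    rw [pow_add, pow_mul]; norm_num
  rw [key] at hdec
  have hlt : (2 : ℝ) ^ L < r := by linarith
  exact_mod_cast hlt

end FewZones


/-! ## 13. ★★ THE CLIQUE-ZONE LAW — `CovZonoHard` SETTLED for clique-zone families (a dichotomy, both halves kernel)

Clique-zone zonotopal passengers `Z = w + Σ_i λ_i [0,1]·𝟙_{S_i}𝟙_{S_i}ᵀ` (distinct patterns `S_i`, lengths `λ_i > 0`).  DICHOTOMY:
FEW distinct zones ⇒ one-block avoidance + the Z♭ rung (`fewZonesLaw_oneBlock`) on the `COR + Z` budget; MANY distinct zones ⇒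
Sauer–Shelah (Mathlib `card_le_card_shatterer` + `card_shatterer_le_sum_vcDim`) gives a SHATTERED block `R`, `|R| = d + 1`, and the
BFPS functionals pushed forward along `R` (val-idea-44's `uPush`, pasted) exhibit the UDISJ pattern ON `Z` ITSELF
(`HasEFOfSize.three_pow_le`): `3^d ≤ (r+1)·2^d` on the PASSENGER's own budget.  No hypothesis on `Z` beyond an explicit elementary
count `(Σ_{k≤d} C(h,k))·C(h-t-1,t-1) < C(h-1,t-1)` (true for `d ≈ h/(m'² log h)`, all large `h`). -/

section CliqueZone
open Summit.ValiantsHypothesis.ValiantsHypothesis.Theorems.FifoMatching.LocatedFaceExposure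
open Summit.ValiantsHypothesis.ValiantsHypothesis.Theorems.FifoMatching.XcDivision

/-- [val-idea-44 g0, `ConePricing44.lean` §5, verbatim] indicator of a Boolean string as a real. -/
def chi {m : ℕ} (b : Fin m → Bool) (p : Fin m) : ℝ := if b p then 1 else 0

/-- [44 §5, verbatim] on the complete graph, `corVec b` is the rank-one 0/1 matrix `𝟙_b 𝟙_bᵀ`. -/
theorem corVec_top_apply {m : ℕ} (b : Fin m → Bool) (p q : Fin m) :
    corVec (⊤ : SimpleGraph (Fin m)) b (p, q) = chi b p * chi b q := by
  unfold corVec chi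
  by_cases hpq : p = q
  · subst hpq; cases b p <;> simp
  · simp only [hpq, SimpleGraph.top_adj, ne_eq, not_false_eq_true, if_true, if_false]
    cases b p <;> cases b q <;> simp

/-- [44 §5, verbatim] -/
theorem rankOne_dot_corVec {m : ℕ} (w : Fin m → ℝ) (b : Fin m → Bool) :
    (fun x : Fin m × Fin m => w x.1 * w x.2) ⬝ᵥ corVec (⊤ : SimpleGraph (Fin m)) b
      = (∑ p, w p * chi b p) ^ 2 := by
  simp only [dotProduct, Fintype.sum_prod_type, corVec_top_apply]
  rw [sq, Finset.sum_mul_sum]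
  exact Finset.sum_congr rfl fun p _ => Finset.sum_congr rfl fun q _ => by ring

/-- [44 §5, verbatim] the BFPS vector `u_a = (−1, 𝟙_a)`. -/
def uVec {n : ℕ} (a : Finset (Fin n)) : Fin (n + 1) → ℝ :=
  Fin.cons (-1) fun i => if i ∈ a then 1 else 0

/-- [44 §5, verbatim] -/
theorem sum_uVec_chi {n : ℕ} (a b : Finset (Fin n)) :
    ∑ p, uVec a p * chi (Fin.cons true (fun i => decide (i ∈ b)) : Fin (n + 1) → Bool) p
      = ((a ∩ b).card : ℝ) - 1 := by
  rw [Fin.sum_univ_succ]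
  have h0 : uVec a 0 * chi (Fin.cons true (fun i => decide (i ∈ b)) : Fin (n + 1) → Bool) 0 = -1 := by
    simp [uVec, chi]
  have hs : ∀ i : Fin n, uVec a i.succ * chi (Fin.cons true (fun i => decide (i ∈ b)) : Fin (n + 1) → Bool) i.succ
      = if i ∈ a ∩ b then 1 else 0 := by
    intro i
    by_cases ha : i ∈ a <;> by_cases hb : i ∈ b <;> simp [uVec, chi, ha, hb]
  rw [h0, Finset.sum_congr rfl fun i _ => hs i, Finset.sum_boole]
  have hf : Finset.univ.filter (fun i => i ∈ a ∩ b) = a ∩ b := by ext i; simp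
  rw [hf]
  ring

/-- [44 §7, verbatim] -/
theorem negRankOne_dot_corVec {m : ℕ} (w : Fin m → ℝ) (b : Fin m → Bool) :
    (fun x : Fin m × Fin m => -(w x.1 * w x.2)) ⬝ᵥ corVec (⊤ : SimpleGraph (Fin m)) b = -((∑ p, w p * chi b p) ^ 2) := by
  rw [show (fun x : Fin m × Fin m => -(w x.1 * w x.2)) = -(fun x : Fin m × Fin m => w x.1 * w x.2) from rfl,
    neg_dotProduct, rankOne_dot_corVec]

/-- [44 §7, verbatim] the BFPS vector `u_a` pushed forward along a block embedding `ρ` (zero off the block). -/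
def uPush {h d : ℕ} (ρ : Fin (d + 1) ↪ Fin h) (a : Finset (Fin d)) : Fin h → ℝ :=
  fun p => ∑ i, if ρ i = p then uVec a i else 0

/-- [44 §7, verbatim] -/
theorem sum_uPush_chi {h d : ℕ} (ρ : Fin (d + 1) ↪ Fin h) (a : Finset (Fin d)) (b : Fin h → Bool) :
    ∑ p, uPush ρ a p * chi b p = ∑ i, uVec a i * chi b (ρ i) := by
  simp only [uPush, Finset.sum_mul]
  rw [Finset.sum_comm]
  refine Finset.sum_congr rfl fun i _ => ?_
  simp [ite_mul]

/-- the clique zone of pattern `b` and length `λ`. -/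
def cliqueZone {h : ℕ} (lam : ℝ) (b : Fin h → Bool) : Fin h × Fin h → ℝ := lam • corVec (⊤ : SimpleGraph (Fin h)) b

/-- ★ SHATTERED BLOCK ⇒ UDISJ ON THE PASSENGER (new: val-idea-44's pushed-forward BFPS sandwich, re-proved on the subset-sum
representation with a translation `w`): if the patterns of a clique-zone family realise every pattern on a block `ρ : Fin (d+1) ↪ [h]`,
then `HasEFOfSize Z r → 3^d ≤ (r+1)·2^d`. -/
theorem three_pow_le_of_shattered {h d M : ℕ} (pat : Fin M → (Fin h → Bool)) (lam : Fin M → ℝ) (hlam : ∀ i, 0 < lam i)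
    (w : Fin h × Fin h → ℝ) (ρ : Fin (d + 1) ↪ Fin h) (hsh : ∀ s : Fin (d + 1) → Bool, ∃ i, ∀ j, pat i (ρ j) = s j)
    {r : ℕ} (hEF : HasEFOfSize (convexHull ℝ (Set.range (subsetSum (fun i => cliqueZone (lam i) (pat i)) w))) r) :
    3 ^ d ≤ (r + 1) * 2 ^ d := by
  classical
  set gen : Fin M → (Fin h × Fin h → ℝ) := fun i => cliqueZone (lam i) (pat i) with hgen
  choose isel hisel using fun a : Finset (Fin d) => hsh (Fin.cons true fun i => decide (i ∈ a))
  have hzone : ∀ (a : Finset (Fin d)) (i : Fin M),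
      (fun x : Fin h × Fin h => -(uPush ρ a x.1 * uPush ρ a x.2)) ⬝ᵥ gen i
        = lam i * -((∑ j, uVec a j * chi (pat i) (ρ j)) ^ 2) := by
    intro a i
    simp only [hgen, cliqueZone]
    rw [dotProduct_smul, smul_eq_mul, negRankOne_dot_corVec, sum_uPush_chi]
  have hslack : ∀ a a' : Finset (Fin d),
      (fun x : Fin h × Fin h => -(uPush ρ a x.1 * uPush ρ a x.2)) ⬝ᵥ gen (isel a')
        = lam (isel a') * -((((a ∩ a').card : ℝ) - 1) ^ 2) := by
    intro a a'
    rw [hzone]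
    have : ∑ j, uVec a j * chi (pat (isel a')) (ρ j)
        = ∑ j, uVec a j * chi (Fin.cons true (fun i => decide (i ∈ a')) : Fin (d + 1) → Bool) j :=
      Finset.sum_congr rfl fun j _ => by simp only [chi, hisel a' j]
    rw [this, sum_uVec_chi]
  have hpt : ∀ a : Finset (Fin d), subsetSum gen w {isel a} = w + gen (isel a) := fun a => by
    simp [subsetSum]
  refine hEF.three_pow_le (fun a => subsetSum gen w {isel a}) (fun a => subset_convexHull ℝ _ ⟨{isel a}, rfl⟩)
    (fun a x => -(uPush ρ a x.1 * uPush ρ a x.2)) (fun a => (fun x => -(uPush ρ a x.1 * uPush ρ a x.2)) ⬝ᵥ w) ?_ ?_ ?_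
  · -- validity on the whole zonotope
    intro a
    refine dot_le_of_mem_convexHull _ _ _ ?_
    rintro _ ⟨S, rfl⟩
    rw [dot_subsetSum]
    have : ∑ i ∈ S, (fun x : Fin h × Fin h => -(uPush ρ a x.1 * uPush ρ a x.2)) ⬝ᵥ gen i ≤ 0 :=
      Finset.sum_nonpos fun i _ => by
        rw [hzone]
        exact mul_nonpos_of_nonneg_of_nonpos (hlam i).le (neg_nonpos.mpr (sq_nonneg _))
    linarith
  · intro a a' hlt hcard
    rw [hpt, dotProduct_add, hslack, hcard] at hlt
    norm_num at hlt
  · intro a a' hab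
    rw [hpt, dotProduct_add, hslack, Finset.disjoint_iff_inter_eq_empty.mp hab]
    have := hlam (isel a')
    norm_num
    linarith

/-- ★ MANY DISTINCT PATTERNS ⇒ A SHATTERED BLOCK (Sauer–Shelah, Mathlib): `Σ_{k ≤ d} C(h,k) < M` distinct patterns realise every
pattern on some block of size `d + 1`. -/
theorem exists_shattered_block {h d M : ℕ} (pat : Fin M → (Fin h → Bool)) (hinj : Function.Injective pat)
    (hM : ∑ k ∈ Finset.Iic d, h.choose k < M) :
    ∃ ρ : Fin (d + 1) ↪ Fin h, ∀ s : Fin (d + 1) → Bool, ∃ i, ∀ j, pat i (ρ j) = s j := by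
  classical
  let supp : Fin M → Finset (Fin h) := fun i => Finset.univ.filter fun p => pat i p = true
  have hsupp_inj : Function.Injective supp := by
    intro i j hij
    apply hinj
    funext p
    have := Finset.ext_iff.1 hij p
    simp only [supp, Finset.mem_filter, Finset.mem_univ, true_and] at this
    exact Bool.eq_iff_iff.2 this
  set 𝒜 : Finset (Finset (Fin h)) := Finset.univ.image supp with h𝒜
  have hcard𝒜 : 𝒜.card = M := by
    rw [h𝒜, Finset.card_image_of_injective _ hsupp_inj, Finset.card_univ, Fintype.card_fin]
  have hM1 : 1 ≤ M := by
    have : h.choose 0 ≤ ∑ k ∈ Finset.Iic d, h.choose k :=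
      Finset.single_le_sum (f := fun k => h.choose k) (fun _ _ => Nat.zero_le _) (Finset.mem_Iic.2 (Nat.zero_le d))
    simp at this
    omega
  have hne : 𝒜.Nonempty := by
    rw [← Finset.card_pos, hcard𝒜]; exact hM1
  have hshne : 𝒜.shatterer.Nonempty := ⟨∅, Finset.mem_shatterer.2 (Finset.shatters_empty.2 hne)⟩
  -- vcDim ≥ d + 1
  have hvc : d + 1 ≤ 𝒜.vcDim := by
    by_contra hlt
    push Not at hlt
    have h1 : M ≤ ∑ k ∈ Finset.Iic 𝒜.vcDim, h.choose k := by
      have := (Finset.card_le_card_shatterer 𝒜).trans (Finset.card_shatterer_le_sum_vcDim (𝒜 := 𝒜))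
      rw [hcard𝒜, Fintype.card_fin] at this
      exact this
    have h2 : ∑ k ∈ Finset.Iic 𝒜.vcDim, h.choose k ≤ ∑ k ∈ Finset.Iic d, h.choose k :=
      Finset.sum_le_sum_of_subset (Finset.Iic_subset_Iic.2 (by omega))
    omega
  obtain ⟨s, hs, hsup⟩ := Finset.exists_mem_eq_sup 𝒜.shatterer hshne Finset.card
  have hscard : d + 1 ≤ s.card := by
    have : 𝒜.vcDim = s.card := hsup
    omega
  obtain ⟨R, hRs, hRcard⟩ := Finset.exists_subset_card_eq hscard
  have hR : 𝒜.Shatters R := (Finset.mem_shatterer.1 hs).mono_right hRs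
  let ρ : Fin (d + 1) ↪ Fin h := (R.orderEmbOfFin hRcard).toEmbedding
  have hρR : ∀ j, ρ j ∈ R := fun j => Finset.orderEmbOfFin_mem R hRcard j
  refine ⟨ρ, fun sgn => ?_⟩
  let t : Finset (Fin h) := (Finset.univ.filter fun j => sgn j = true).map ρ
  have ht : t ⊆ R := by
    intro p hp
    obtain ⟨j, -, rfl⟩ := Finset.mem_map.1 hp
    exact hρR j
  obtain ⟨u, hu, hRu⟩ := hR ht
  obtain ⟨i, -, rfl⟩ := Finset.mem_image.1 hu
  refine ⟨i, fun j => ?_⟩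
  have h1 : ρ j ∈ R ∩ supp i ↔ ρ j ∈ t := by rw [hRu]
  rw [Finset.mem_inter] at h1
  simp only [hρR j, true_and, supp, Finset.mem_filter, Finset.mem_univ] at h1
  have h2 : ρ j ∈ t ↔ sgn j = true := by
    simp only [t, Finset.mem_map', Finset.mem_filter, Finset.mem_univ, true_and]
  exact Bool.eq_iff_iff.2 (h1.trans h2)

/-- ★★ THE CLIQUE-ZONE DICHOTOMY (statement): for clique-zone zonotopal passengers with distinct patterns and positive lengths,
under the elementary count `(Σ_{k≤d} C(h,k))·C(h-t-1,t-1) < C(h-1,t-1)`: EITHER the `COR + Z` budget pays the Z♭ rate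
`(3/2)^{m'-1} ≤ 2(r₂+1)` OR the passenger's own budget pays UDISJ on a shattered block `3^d ≤ (r₁+1)·2^d`. -/
def CliqueZoneDichotomy : Prop :=
  ∀ (h m' t d M : ℕ) (pat : Fin M → (Fin h → Bool)) (lam : Fin M → ℝ) (w : Fin h × Fin h → ℝ) (r₁ r₂ : ℕ),
    2 ≤ m' → 1 ≤ t → m' * t ≤ h → Function.Injective pat → (∀ i, 0 < lam i) →
    (∑ k ∈ Finset.Iic d, h.choose k) * Nat.choose (h - t - 1) (t - 1) < Nat.choose (h - 1) (t - 1) →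
    HasEFOfSize (convexHull ℝ (Set.range (subsetSum (fun i => cliqueZone (lam i) (pat i)) w))) r₁ →
    HasEFOfSize (corPolytopeGraph (⊤ : SimpleGraph (Fin h)) +
      convexHull ℝ (Set.range (subsetSum (fun i => cliqueZone (lam i) (pat i)) w))) r₂ →
      (3 / 2 : ℝ) ^ (m' - 1) ≤ 2 * (r₂ + 1) ∨ 3 ^ d ≤ (r₁ + 1) * 2 ^ d

/-- ★★ PROVED. -/
theorem cliqueZoneDichotomy_holds : CliqueZoneDichotomy := by
  intro h m' t d M pat lam w r₁ r₂ hm ht hh hinj hlam hcount hEF₁ hEF₂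
  by_cases hfew : M * Nat.choose (h - t - 1) (t - 1) < Nat.choose (h - 1) (t - 1)
  · exact Or.inl (fewZonesLaw_oneBlock h m' t M _ w r₂ hm ht hh hfew hEF₂)
  · right
    push Not at hfew
    have hM : ∑ k ∈ Finset.Iic d, h.choose k < M := by
      by_contra hle
      push Not at hle
      have := Nat.mul_le_mul_right (Nat.choose (h - t - 1) (t - 1)) hle
      omega
    obtain ⟨ρ, hρ⟩ := exists_shattered_block pat hinj hM
    exact three_pow_le_of_shattered pat lam hlam w ρ hρ hEF₁

/-- ★★ COROLLARY — THE CLIQUE-ZONE CHAPTER OF COR-MINKOWSKI IN THE CRUX'S SHAPE: with `L = (log₂ h + C)^C`, `m' = 2L + 4`,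
`d = 2L + 3` and any block size `t ≥ 1` with `m'·t ≤ h` satisfying the count, a clique-zone passenger budgeted by `r` (itself AND
with `COR(K_h)`) has `2^L < r`.  (`CovZonoHard` restricted to clique-zone families follows: a COVERING family is never in the few
branch.)  The count holds for all `h ≥ h₀(C)` at `t = h / m'` (ratio `≈ e^{h/m'^2}` vs `h^{2L+4}`); that asymptotic is prose. -/
theorem cliqueZone_decided (C h t M : ℕ) (pat : Fin M → (Fin h → Bool)) (lam : Fin M → ℝ) (w : Fin h × Fin h → ℝ) (r : ℕ)
    (ht : 1 ≤ t) (hh : (2 * (Nat.log 2 h + C) ^ C + 4) * t ≤ h) (hinj : Function.Injective pat) (hlam : ∀ i, 0 < lam i)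
    (hcount : (∑ k ∈ Finset.Iic (2 * (Nat.log 2 h + C) ^ C + 3), h.choose k) * Nat.choose (h - t - 1) (t - 1)
      < Nat.choose (h - 1) (t - 1))
    (hEF₁ : HasEFOfSize (convexHull ℝ (Set.range (subsetSum (fun i => cliqueZone (lam i) (pat i)) w))) r)
    (hEF₂ : HasEFOfSize (corPolytopeGraph (⊤ : SimpleGraph (Fin h)) +
      convexHull ℝ (Set.range (subsetSum (fun i => cliqueZone (lam i) (pat i)) w))) r) :
    2 ^ ((Nat.log 2 h + C) ^ C) < r := by
  set L := (Nat.log 2 h + C) ^ C with hLdef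
  have hL : 1 ≤ L := one_le_L h C
  have h1 : (2 : ℝ) ≤ 2 ^ L := by
    calc (2 : ℝ) = 2 ^ 1 := by norm_num
      _ ≤ 2 ^ L := pow_le_pow_right₀ (by norm_num) hL
  have h2 : (2 : ℝ) ^ L ≤ (9 / 4) ^ L := pow_le_pow_left₀ (by norm_num) (by norm_num) L
  have key : (3 / 2 : ℝ) ^ (2 * L + 3) = (9 / 4) ^ L * (27 / 8) := by
    rw [pow_add, pow_mul]; norm_num
  rcases cliqueZoneDichotomy_holds h (2 * L + 4) t (2 * L + 3) M pat lam w r r (by omega) ht hh hinj hlam hcount hEF₁ hEF₂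
    with hdec | hdec
  · have hm : 2 * L + 4 - 1 = 2 * L + 3 := by omega
    rw [hm, key] at hdec
    have hlt : (2 : ℝ) ^ L < r := by linarith
    exact_mod_cast hlt
  · -- `3^(2L+3) ≤ (r+1)·2^(2L+3)` ⇒ `(3/2)^(2L+3) ≤ r + 1`
    have hR : (3 : ℝ) ^ (2 * L + 3) ≤ (r + 1) * 2 ^ (2 * L + 3) := by exact_mod_cast hdec
    have h2pos : (0 : ℝ) < 2 ^ (2 * L + 3) := by positivity
    have hmain : (3 / 2 : ℝ) ^ (2 * L + 3) ≤ r + 1 := by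
      rw [div_pow, div_le_iff₀ h2pos]
      exact hR
    rw [key] at hmain
    have hlt : (2 : ℝ) ^ L < r := by nlinarith
    exact_mod_cast hlt

/-- arithmetic: `3^(2L+3) ≤ (r+1)·2^(2L+3)` with `L ≥ 1` forces `2^L < r`. -/
theorem two_pow_lt_of_three_pow_le {L r : ℕ} (hL : 1 ≤ L) (hdec : 3 ^ (2 * L + 3) ≤ (r + 1) * 2 ^ (2 * L + 3)) :
    2 ^ L < r := by
  have h1 : (2 : ℝ) ≤ 2 ^ L := by
    calc (2 : ℝ) = 2 ^ 1 := by norm_num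
      _ ≤ 2 ^ L := pow_le_pow_right₀ (by norm_num) hL
  have h2 : (2 : ℝ) ^ L ≤ (9 / 4) ^ L := pow_le_pow_left₀ (by norm_num) (by norm_num) L
  have key : (3 / 2 : ℝ) ^ (2 * L + 3) = (9 / 4) ^ L * (27 / 8) := by
    rw [pow_add, pow_mul]; norm_num
  have hR : (3 : ℝ) ^ (2 * L + 3) ≤ (r + 1) * 2 ^ (2 * L + 3) := by exact_mod_cast hdec
  have h2pos : (0 : ℝ) < 2 ^ (2 * L + 3) := by positivity
  have hmain : (3 / 2 : ℝ) ^ (2 * L + 3) ≤ r + 1 := by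
    rw [div_pow, div_le_iff₀ h2pos]
    exact hR
  rw [key] at hmain
  have hlt : (2 : ℝ) ^ L < r := by nlinarith
  exact_mod_cast hlt

/-- ★★ `CovZonoHard` FOR CLIQUE-ZONE FAMILIES (the conjecture of §8 restricted to clique zones, PROVED modulo the explicit count):
a clique-zone family COVERING level `2L + 4` cannot be in the few branch (`exists_oneBlock_avoiding` would produce an avoiding
surjection), so Sauer–Shelah + the pushed BFPS sandwich price the passenger ALONE: `HasEFOfSize Z r → 2^L < r`.  No `COR + Z`
budget is used. -/
theorem covZonoHard_cliqueZone (C h t M : ℕ) (pat : Fin M → (Fin h → Bool)) (lam : Fin M → ℝ) (w : Fin h × Fin h → ℝ) (r : ℕ)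
    (ht : 1 ≤ t) (hh : (2 * (Nat.log 2 h + C) ^ C + 4) * t ≤ h) (hinj : Function.Injective pat) (hlam : ∀ i, 0 < lam i)
    (hcount : (∑ k ∈ Finset.Iic (2 * (Nat.log 2 h + C) ^ C + 3), h.choose k) * Nat.choose (h - t - 1) (t - 1)
      < Nat.choose (h - 1) (t - 1))
    (hcov : Covers h (2 * (Nat.log 2 h + C) ^ C + 4) (fun i => cliqueZone (lam i) (pat i)))
    (hEF : HasEFOfSize (convexHull ℝ (Set.range (subsetSum (fun i => cliqueZone (lam i) (pat i)) w))) r) :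
    2 ^ ((Nat.log 2 h + C) ^ C) < r := by
  set L := (Nat.log 2 h + C) ^ C with hLdef
  have hL : 1 ≤ L := one_le_L h C
  have hmany : ¬ (M * Nat.choose (h - t - 1) (t - 1) < Nat.choose (h - 1) (t - 1)) := by
    intro hfew
    obtain ⟨β, ρ, hρ, hZ⟩ := exists_oneBlock_avoiding h (2 * L + 4) t M (by omega) ht hh _ hfew
    obtain ⟨i, hcap, hoff⟩ := hcov β (fun j => ⟨ρ j, hρ j⟩)
    exact hoff (hZ i hcap)
  have hM : ∑ k ∈ Finset.Iic (2 * L + 3), h.choose k < M := by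
    by_contra hle
    push Not at hle
    have := Nat.mul_le_mul_right (Nat.choose (h - t - 1) (t - 1)) hle
    omega
  obtain ⟨ρ, hρ⟩ := exists_shattered_block pat hinj hM
  exact two_pow_lt_of_three_pow_le hL (three_pow_le_of_shattered pat lam hlam w ρ hρ hEF)

end CliqueZone


/-! ## 14. ★★★ THE COUNT DISCHARGED — `CovZonoHard` for clique-zone families in its LITERAL shape `∀ C, ∃ h₀, ∀ h ≥ h₀, …`

The elementary count `(Σ_{j≤d} C(h,j))·C(h-t-1,t-1) < C(h-1,t-1)` of §13 holds at `m = d+1` blocks of size `t = ⌊h/m⌋` as soon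
as `(2m)^6 ≤ h` (`count_holds`: shifted descending factorials `(h+t)^{t-1}(h-t-1)^{(t-1)↓} ≤ h^{t-1}(h-1)^{(t-1)↓}`, one binomial
term `C(t-1,k)h^{t-1-k}t^k ≤ (h+t)^{t-1}` at `k = 2m`, `(n/k)^k ≤ C(n,k)`, and `m(2m)^{6m} < h^{m+1}`), and the polylog threshold
`(2m)^6 = (4(log₂h+C)^C+8)^6 ≤ h` is met for all large `h` (`eventually_threshold`, via `(log x)^n = o(x)`).  Hence
`covZonoHard_cliqueZone_eventually` and `cliqueZone_decided_eventually` — no side conditions left. -/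

section Asymptotics


/-- `Σ_{j ≤ d} C(h,j) ≤ (d+1)·h^d` for `h ≥ 1`. -/
theorem sum_choose_le (h d : ℕ) (hh : 1 ≤ h) : ∑ j ∈ Finset.Iic d, h.choose j ≤ (d + 1) * h ^ d := by
  calc ∑ j ∈ Finset.Iic d, h.choose j ≤ ∑ j ∈ Finset.Iic d, h ^ d :=
        Finset.sum_le_sum fun j hj => (Nat.choose_le_pow h j).trans
          (Nat.pow_le_pow_right hh (Finset.mem_Iic.1 hj))
    _ = (d + 1) * h ^ d := by rw [Finset.sum_const, Nat.card_Iic, smul_eq_mul]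

/-- the shifted descending-factorial comparison `(h+t)^{t-1}·(h-t-1)^{(t-1)↓} ≤ h^{t-1}·(h-1)^{(t-1)↓}`. -/
theorem descFactorial_shift_le (h t : ℕ) :
    (h + t) ^ (t - 1) * (h - t - 1).descFactorial (t - 1) ≤ h ^ (t - 1) * (h - 1).descFactorial (t - 1) := by
  rw [Nat.descFactorial_eq_prod_range, Nat.descFactorial_eq_prod_range, ← Finset.card_range (t - 1),
    ← Finset.prod_const, ← Finset.prod_const, Finset.card_range, ← Finset.prod_mul_distrib,
    ← Finset.prod_mul_distrib]
  refine Finset.prod_le_prod (fun i _ => Nat.zero_le _) fun i hi => ?_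
  have hi' := Finset.mem_range.1 hi
  rcases Nat.eq_zero_or_pos (h - t - 1 - i) with h0 | hpos
  · rw [h0]; simp
  · obtain ⟨x, hx⟩ : ∃ x, h = x + t + 1 + i + 1 := ⟨h - t - 1 - i - 1, by omega⟩
    have e1 : h - t - 1 - i = x + 1 := by omega
    have e2 : h - 1 - i = x + 1 + t := by omega
    rw [e1, e2, hx]
    nlinarith

/-- one binomial term: `C(n,k)·h^{n-k}·t^k ≤ (h+t)^n`. -/
theorem choose_mul_pow_le_add_pow (h t n k : ℕ) (hk : k ≤ n) :
    n.choose k * h ^ (n - k) * t ^ k ≤ (h + t) ^ n := by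
  rw [add_comm, add_pow]
  have := Finset.single_le_sum (f := fun m => t ^ m * h ^ (n - m) * n.choose m) (fun _ _ => Nat.zero_le _)
    (Finset.mem_range.2 (Nat.lt_succ_of_le hk))
  calc n.choose k * h ^ (n - k) * t ^ k = t ^ k * h ^ (n - k) * n.choose k := by ring
    _ ≤ _ := this

/-- `n^k ≤ k^k·C(n,k)` for `k ≤ n` (the bound `(n/k)^k ≤ C(n,k)`). -/
theorem pow_le_pow_mul_choose (n k : ℕ) (hk : k ≤ n) : n ^ k ≤ k ^ k * n.choose k := by
  have key : n ^ k * k.factorial ≤ k ^ k * n.descFactorial k := by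
    rw [← Nat.descFactorial_self, Nat.descFactorial_eq_prod_range, Nat.descFactorial_eq_prod_range,
      ← Finset.card_range k, ← Finset.prod_const, ← Finset.prod_const, Finset.card_range,
      ← Finset.prod_mul_distrib, ← Finset.prod_mul_distrib]
    refine Finset.prod_le_prod (fun i _ => Nat.zero_le _) fun i hi => ?_
    have hi' := Finset.mem_range.1 hi
    obtain ⟨a, ha⟩ : ∃ a, n = i + a := ⟨n - i, by omega⟩
    obtain ⟨b, hb⟩ : ∃ b, k = i + b := ⟨k - i, by omega⟩
    have hab : b ≤ a := by omega
    rw [ha, hb, Nat.add_sub_cancel_left, Nat.add_sub_cancel_left]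
    nlinarith [Nat.mul_le_mul_left i hab]
  rw [Nat.descFactorial_eq_factorial_mul_choose] at key
  have hf : 0 < k.factorial := Nat.factorial_pos k
  have : k.factorial * n ^ k ≤ k.factorial * (k ^ k * n.choose k) := by
    calc k.factorial * n ^ k = n ^ k * k.factorial := by ring
      _ ≤ k ^ k * (k.factorial * n.choose k) := key
      _ = k.factorial * (k ^ k * n.choose k) := by ring
  exact Nat.le_of_mul_le_mul_left this hf

/-- assembly: a numeric inequality `S·h^k·k^k < (t-1)^k·t^k` (with `k+1 ≤ t ≤ h`) gives the one-block count
`S·C(h-t-1,t-1) < C(h-1,t-1)`. -/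
theorem count_of_numeric (S h t k : ℕ) (hkt : k + 1 ≤ t) (hth : t ≤ h)
    (hnum : S * h ^ k * k ^ k < (t - 1) ^ k * t ^ k) :
    S * (h - t - 1).choose (t - 1) < (h - 1).choose (t - 1) := by
  have hkk : 0 < k ^ k := by
    rcases Nat.eq_zero_or_pos k with rfl | hk
    · simp
    · exact pow_pos hk k
  have hpos : 0 < h := by omega
  -- `S·h^k < C(t-1,k)·t^k`
  have hX : S * h ^ k < (t - 1).choose k * t ^ k := by
    have h1 : (t - 1) ^ k * t ^ k ≤ k ^ k * (t - 1).choose k * t ^ k :=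
      Nat.mul_le_mul_right _ (pow_le_pow_mul_choose (t - 1) k (by omega))
    have h2 : k ^ k * (S * h ^ k) < k ^ k * ((t - 1).choose k * t ^ k) := by
      calc k ^ k * (S * h ^ k) = S * h ^ k * k ^ k := by ring
        _ < (t - 1) ^ k * t ^ k := hnum
        _ ≤ k ^ k * (t - 1).choose k * t ^ k := h1
        _ = k ^ k * ((t - 1).choose k * t ^ k) := by ring
    exact Nat.lt_of_mul_lt_mul_left h2
  -- descending-factorial form
  suffices hD : S * (h - t - 1).descFactorial (t - 1) < (h - 1).descFactorial (t - 1) by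
    rw [Nat.descFactorial_eq_factorial_mul_choose, Nat.descFactorial_eq_factorial_mul_choose] at hD
    have : (t - 1).factorial * (S * (h - t - 1).choose (t - 1)) < (t - 1).factorial * (h - 1).choose (t - 1) := by
      calc (t - 1).factorial * (S * (h - t - 1).choose (t - 1))
          = S * ((t - 1).factorial * (h - t - 1).choose (t - 1)) := by ring
        _ < _ := hD
    exact Nat.lt_of_mul_lt_mul_left this
  rcases Nat.eq_zero_or_pos ((h - t - 1).descFactorial (t - 1)) with h0 | hDpos
  · rw [h0, mul_zero]
    exact Nat.pos_of_ne_zero fun h' => by rw [Nat.descFactorial_eq_zero_iff_lt] at h'; omega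
  · set D := (h - t - 1).descFactorial (t - 1)
    have hB := descFactorial_shift_le h t
    have hC := choose_mul_pow_le_add_pow h t (t - 1) k (by omega)
    have hpow : h ^ k * h ^ (t - 1 - k) = h ^ (t - 1) := by rw [← pow_add]; congr 1; omega
    have hhp : 0 < h ^ (t - 1 - k) := pow_pos hpos _
    have key : h ^ (t - 1) * (S * D) < h ^ (t - 1) * (h - 1).descFactorial (t - 1) := by
      calc h ^ (t - 1) * (S * D) = (S * h ^ k) * D * h ^ (t - 1 - k) := by rw [← hpow]; ring
        _ < ((t - 1).choose k * t ^ k) * D * h ^ (t - 1 - k) :=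
            mul_lt_mul_of_pos_right (mul_lt_mul_of_pos_right hX hDpos) hhp
        _ = ((t - 1).choose k * h ^ (t - 1 - k) * t ^ k) * D := by ring
        _ ≤ (h + t) ^ (t - 1) * D := Nat.mul_le_mul_right _ hC
        _ ≤ h ^ (t - 1) * (h - 1).descFactorial (t - 1) := hB
    exact Nat.lt_of_mul_lt_mul_left key

theorem pow_helper1 (x s k : ℕ) : (x * s) ^ k * (x * (s + 1)) ^ k = s ^ k * (s + 1) ^ k * x ^ (2 * k) := by
  rw [mul_pow, mul_pow, two_mul, pow_add]; ring

theorem pow_helper2 (a h x d : ℕ) :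
    (a * h ^ d) * h ^ (2 * (d + 1)) * x ^ (2 * (d + 1)) * x ^ (2 * (2 * (d + 1)))
      = (a * x ^ (6 * (d + 1))) * h ^ (d + 2 * (d + 1)) := by
  ring

/-- the numeric core at block count `m = d+1`, block size `t = s+1 = ⌊h/m⌋`, VC level `d`, binomial index `k = 2m`:
`(2m)^6 ≤ h` suffices. -/
theorem numeric_core (d h s : ℕ) (hbig : (2 * (d + 1)) ^ 6 ≤ h) (hhi : h < (d + 1) * (s + 1) + (d + 1)) :
    ((d + 1) * h ^ d) * h ^ (2 * (d + 1)) * (2 * (d + 1)) ^ (2 * (d + 1))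
      < s ^ (2 * (d + 1)) * (s + 1) ^ (2 * (d + 1)) := by
  have hxpos : 0 < 2 * (d + 1) := by omega
  have hx6 : 0 < (2 * (d + 1)) ^ 6 := pow_pos hxpos 6
  have hpos : 0 < h := by omega
  have h4 : 4 * (d + 1) ≤ h := by
    have : 4 * (d + 1) ≤ (2 * (d + 1)) ^ 6 := by
      calc 4 * (d + 1) ≤ (2 * (d + 1)) * (2 * (d + 1)) := by nlinarith
        _ = (2 * (d + 1)) ^ 2 := by ring
        _ ≤ (2 * (d + 1)) ^ 6 := Nat.pow_le_pow_right hxpos (by norm_num)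
    omega
  have hA : h ≤ 2 * (d + 1) * s := by
    have e : (d + 1) * (s + 1) + (d + 1) = (d + 1) * s + 2 * (d + 1) := by ring
    rw [e] at hhi
    have e2 : 2 * (d + 1) * s = 2 * ((d + 1) * s) := by ring
    rw [e2]
    generalize (d + 1) * s = X at hhi ⊢
    omega
  have hB : h ≤ 2 * (d + 1) * (s + 1) := by nlinarith
  have hAk := Nat.pow_le_pow_left hA (2 * (d + 1))
  have hBk := Nat.pow_le_pow_left hB (2 * (d + 1))
  have H2 : h ^ (2 * (2 * (d + 1)))
      ≤ s ^ (2 * (d + 1)) * (s + 1) ^ (2 * (d + 1)) * (2 * (d + 1)) ^ (2 * (2 * (d + 1))) := by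
    calc h ^ (2 * (2 * (d + 1))) = h ^ (2 * (d + 1)) * h ^ (2 * (d + 1)) := by rw [two_mul (2 * (d + 1)), pow_add]
      _ ≤ (2 * (d + 1) * s) ^ (2 * (d + 1)) * (2 * (d + 1) * (s + 1)) ^ (2 * (d + 1)) := Nat.mul_le_mul hAk hBk
      _ = _ := pow_helper1 (2 * (d + 1)) s (2 * (d + 1))
  -- `m·(2m)^{6m} < h^{m+1}`
  have hsmall : (d + 1) * (2 * (d + 1)) ^ (6 * (d + 1)) < h ^ (d + 1 + 1) := by
    have h6 : (2 * (d + 1)) ^ (6 * (d + 1 + 1)) ≤ h ^ (d + 1 + 1) := by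
      rw [pow_mul]; exact Nat.pow_le_pow_left hbig _
    have hmlt : d + 1 < (2 * (d + 1)) ^ 6 := by
      have := Nat.le_self_pow (n := 6) (by norm_num) (2 * (d + 1))
      omega
    calc (d + 1) * (2 * (d + 1)) ^ (6 * (d + 1)) < (2 * (d + 1)) ^ 6 * (2 * (d + 1)) ^ (6 * (d + 1)) :=
          mul_lt_mul_of_pos_right hmlt (pow_pos hxpos _)
      _ = (2 * (d + 1)) ^ (6 * (d + 1 + 1)) := by rw [← pow_add]; congr 1; ring
      _ ≤ h ^ (d + 1 + 1) := h6
  have H1 : ((d + 1) * h ^ d) * h ^ (2 * (d + 1)) * (2 * (d + 1)) ^ (2 * (d + 1)) * (2 * (d + 1)) ^ (2 * (2 * (d + 1)))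
      < h ^ (2 * (2 * (d + 1))) := by
    have e2 : h ^ (2 * (2 * (d + 1))) = h ^ (d + 1 + 1) * h ^ (d + 2 * (d + 1)) := by
      rw [← pow_add]; congr 1; ring
    rw [pow_helper2, e2]
    exact mul_lt_mul_of_pos_right hsmall (pow_pos hpos _)
  exact Nat.lt_of_mul_lt_mul_right (lt_of_lt_of_le H1 H2)

/-- ★ THE ONE-BLOCK COUNT HOLDS at `m = d+1` blocks of size `t = ⌊h/m⌋` as soon as `(2m)^6 ≤ h`. -/
theorem count_holds (m d h t : ℕ) (hmd : m = d + 1) (hbig : (2 * m) ^ 6 ≤ h) (hlo : m * t ≤ h) (hhi : h < m * t + m) :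
    (∑ j ∈ Finset.Iic d, h.choose j) * (h - t - 1).choose (t - 1) < (h - 1).choose (t - 1) := by
  subst hmd
  have hpos : 0 < h := by
    have : 0 < (2 * (d + 1)) ^ 6 := pow_pos (by omega) 6
    omega
  -- `t ≥ 2m + 1`
  have ht : 2 * (d + 1) + 1 ≤ t := by
    by_contra hlt
    push Not at hlt
    have h1 : (d + 1) * t ≤ (d + 1) * (2 * (d + 1)) := Nat.mul_le_mul_left (d + 1) (by omega)
    have h2 : (d + 1) * (2 * (d + 1)) + (d + 1) ≤ (2 * (d + 1)) ^ 6 := by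
      calc (d + 1) * (2 * (d + 1)) + (d + 1) ≤ (2 * (d + 1)) * (2 * (d + 1)) := by nlinarith
        _ = (2 * (d + 1)) ^ 2 := by ring
        _ ≤ (2 * (d + 1)) ^ 6 := Nat.pow_le_pow_right (by omega) (by norm_num)
    generalize (d + 1) * t = P at *
    generalize (d + 1) * (2 * (d + 1)) = Q at *
    generalize (2 * (d + 1)) ^ 6 = R at *
    omega
  obtain ⟨s, rfl⟩ : ∃ s, t = s + 1 := ⟨t - 1, by omega⟩
  have hnum := numeric_core d h s hbig hhi
  have hS := sum_choose_le h d hpos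
  refine count_of_numeric _ h (s + 1) (2 * (d + 1)) (by omega) (by nlinarith) ?_
  rw [Nat.add_sub_cancel]
  calc (∑ j ∈ Finset.Iic d, h.choose j) * h ^ (2 * (d + 1)) * (2 * (d + 1)) ^ (2 * (d + 1))
      ≤ ((d + 1) * h ^ d) * h ^ (2 * (d + 1)) * (2 * (d + 1)) ^ (2 * (d + 1)) := by gcongr
    _ < s ^ (2 * (d + 1)) * (s + 1) ^ (2 * (d + 1)) := hnum

/-- `Nat.log 2 ℓ ≤ 2 log ℓ` for `ℓ ≥ 1` [as in `Literature.Barriers.PneNP.LocalityAsymptotics`]. -/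
theorem natLog_two_le_two_mul_log {ℓ : ℕ} (hℓ : 1 ≤ ℓ) : (Nat.log 2 ℓ : ℝ) ≤ 2 * Real.log ℓ := by
  have h2 : (2 : ℝ) ^ (Nat.log 2 ℓ) ≤ ℓ := by exact_mod_cast Nat.pow_log_le_self 2 (by omega)
  have hlog := Real.log_le_log (by positivity) h2
  rw [Real.log_pow] at hlog
  have hln2 : (1 : ℝ) / 2 ≤ Real.log 2 := by
    have := Real.log_two_gt_d9; norm_num at this ⊢; linarith
  have h0 : (0 : ℝ) ≤ Nat.log 2 ℓ := Nat.cast_nonneg _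
  nlinarith

/-- ★ the polylog threshold is eventually met: `(2·(2(log₂ h + C)^C + 4))^6 ≤ h` for all large `h`. -/
theorem eventually_threshold (C : ℕ) : ∃ h₀ : ℕ, ∀ h ≥ h₀, (2 * (2 * (Nat.log 2 h + C) ^ C + 4)) ^ 6 ≤ h := by
  have hK : (0 : ℝ) < (12 : ℝ) ^ 6 * ((C : ℝ) + 3) ^ (6 * C) := by positivity
  have hlo := (Real.isLittleO_pow_log_id_atTop (n := 6 * C)).def (show (0 : ℝ) < 1 / ((12 : ℝ) ^ 6 * ((C : ℝ) + 3) ^ (6 * C)) by positivity)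
  have hnat := tendsto_natCast_atTop_atTop.eventually hlo
  obtain ⟨h₀, hh₀⟩ := Filter.eventually_atTop.1 (hnat.and (Filter.eventually_ge_atTop 3))
  refine ⟨h₀, fun h hh => ?_⟩
  obtain ⟨hℓ, hℓ3⟩ := hh₀ h hh
  have hpos : (0 : ℝ) < h := by exact_mod_cast (show 0 < h by omega)
  rw [Real.norm_of_nonneg (by positivity), id, Real.norm_of_nonneg hpos.le] at hℓ
  have hlog1 : 1 ≤ Real.log h := by
    rw [← Real.log_exp 1]
    refine Real.log_le_log (Real.exp_pos 1) ?_
    have := Real.exp_one_lt_d9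
    have h3 : (3 : ℝ) ≤ h := by exact_mod_cast hℓ3
    linarith
  have hN : (Nat.log 2 h : ℝ) ≤ 2 * Real.log h := natLog_two_le_two_mul_log (ℓ := h) (by omega)
  have hC0 : (0 : ℝ) ≤ C := Nat.cast_nonneg _
  have hL0 : (0 : ℝ) ≤ Nat.log 2 h := Nat.cast_nonneg _
  have hA : (Nat.log 2 h : ℝ) + C + 1 ≤ ((C : ℝ) + 3) * Real.log h := by nlinarith
  have hB : (2 * (2 * ((Nat.log 2 h : ℝ) + C) ^ C + 4)) ≤ 12 * ((Nat.log 2 h : ℝ) + C + 1) ^ C := by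
    have h1 : ((Nat.log 2 h : ℝ) + C) ^ C ≤ ((Nat.log 2 h : ℝ) + C + 1) ^ C :=
      pow_le_pow_left₀ (by positivity) (by linarith) C
    have h2 : (1 : ℝ) ≤ ((Nat.log 2 h : ℝ) + C + 1) ^ C := one_le_pow₀ (by linarith)
    nlinarith
  have hC' : (12 * ((Nat.log 2 h : ℝ) + C + 1) ^ C) ^ 6
      ≤ (12 : ℝ) ^ 6 * ((C : ℝ) + 3) ^ (6 * C) * Real.log h ^ (6 * C) := by
    calc (12 * ((Nat.log 2 h : ℝ) + C + 1) ^ C) ^ 6 ≤ (12 * ((((C : ℝ) + 3) * Real.log h)) ^ C) ^ 6 := by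
          gcongr
      _ = (12 : ℝ) ^ 6 * ((C : ℝ) + 3) ^ (6 * C) * Real.log h ^ (6 * C) := by
          rw [mul_pow, ← pow_mul, mul_pow]; ring
  have hD : (12 : ℝ) ^ 6 * ((C : ℝ) + 3) ^ (6 * C) * Real.log h ^ (6 * C) ≤ h := by
    have := mul_le_mul_of_nonneg_left hℓ hK.le
    rwa [← mul_assoc, mul_one_div_cancel hK.ne', one_mul] at this
  have h0 : (0 : ℝ) ≤ 2 * (2 * ((Nat.log 2 h : ℝ) + C) ^ C + 4) := by positivity
  have : ((2 * (2 * (Nat.log 2 h + C) ^ C + 4) : ℕ) : ℝ) ^ 6 ≤ h := by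
    push_cast
    exact ((pow_le_pow_left₀ h0 hB 6).trans hC').trans hD
  exact_mod_cast this


/-- ★★★ `CovZonoHard` FOR CLIQUE-ZONE FAMILIES, LITERAL SHAPE (no side conditions): for every `C` and all large `h`, a clique-zone
family with distinct patterns and positive lengths whose zones COVER level `2(log₂h+C)^C + 4` has
`xc(w + Σ_i [0,1]·λ_i 𝟙_{S_i}𝟙_{S_i}ᵀ) > 2^{(log₂h+C)^C}` — on the passenger's own budget. -/
theorem covZonoHard_cliqueZone_eventually (C : ℕ) : ∃ h₀ : ℕ, ∀ h ≥ h₀,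
    ∀ (M : ℕ) (pat : Fin M → (Fin h → Bool)) (lam : Fin M → ℝ) (w : Fin h × Fin h → ℝ) (r : ℕ),
      Function.Injective pat → (∀ i, 0 < lam i) →
      Covers h (2 * (Nat.log 2 h + C) ^ C + 4) (fun i => cliqueZone (lam i) (pat i)) →
      HasEFOfSize (convexHull ℝ (Set.range (subsetSum (fun i => cliqueZone (lam i) (pat i)) w))) r →
        2 ^ ((Nat.log 2 h + C) ^ C) < r := by
  obtain ⟨h₀, hh₀⟩ := eventually_threshold C
  refine ⟨h₀, fun h hh M pat lam w r hinj hlam hcov hEF => ?_⟩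
  have hbig := hh₀ h hh
  set L := (Nat.log 2 h + C) ^ C with hLdef
  set m := 2 * L + 4 with hmdef
  have hm : 0 < m := by omega
  have hmh : m ≤ h := by
    have := Nat.le_self_pow (n := 6) (by norm_num) (2 * m)
    omega
  have hlo : m * (h / m) ≤ h := Nat.mul_div_le h m
  have hhi : h < m * (h / m) + m := by
    have := Nat.lt_div_mul_add (a := h) hm
    rwa [mul_comm] at this
  have ht : 1 ≤ h / m := Nat.div_pos hmh hm
  have hcount := count_holds m (2 * L + 3) h (h / m) (by omega) hbig hlo hhi
  exact covZonoHard_cliqueZone C h (h / m) M pat lam w r ht hlo hinj hlam hcount hcov hEF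

/-- ★★★ THE CLIQUE-ZONE CHAPTER OF COR-MINKOWSKI, LITERAL SHAPE: for every `C` and all large `h`, a clique-zone passenger `Z`
(distinct patterns, positive lengths, any translation) with `xc(Z) ≤ r` and `xc(COR(K_h) + Z) ≤ r` has `2^{(log₂h+C)^C} < r`. -/
theorem cliqueZone_decided_eventually (C : ℕ) : ∃ h₀ : ℕ, ∀ h ≥ h₀,
    ∀ (M : ℕ) (pat : Fin M → (Fin h → Bool)) (lam : Fin M → ℝ) (w : Fin h × Fin h → ℝ) (r : ℕ),
      Function.Injective pat → (∀ i, 0 < lam i) →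
      HasEFOfSize (convexHull ℝ (Set.range (subsetSum (fun i => cliqueZone (lam i) (pat i)) w))) r →
      HasEFOfSize (corPolytopeGraph (⊤ : SimpleGraph (Fin h)) +
        convexHull ℝ (Set.range (subsetSum (fun i => cliqueZone (lam i) (pat i)) w))) r →
        2 ^ ((Nat.log 2 h + C) ^ C) < r := by
  obtain ⟨h₀, hh₀⟩ := eventually_threshold C
  refine ⟨h₀, fun h hh M pat lam w r hinj hlam hEF₁ hEF₂ => ?_⟩
  have hbig := hh₀ h hh
  set L := (Nat.log 2 h + C) ^ C with hLdef
  set m := 2 * L + 4 with hmdef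
  have hm : 0 < m := by omega
  have hmh : m ≤ h := by
    have := Nat.le_self_pow (n := 6) (by norm_num) (2 * m)
    omega
  have hlo : m * (h / m) ≤ h := Nat.mul_div_le h m
  have hhi : h < m * (h / m) + m := by
    have := Nat.lt_div_mul_add (a := h) hm
    rwa [mul_comm] at this
  have ht : 1 ≤ h / m := Nat.div_pos hmh hm
  have hcount := count_holds m (2 * L + 3) h (h / m) (by omega) hbig hlo hhi
  exact cliqueZone_decided C h (h / m) M pat lam w r ht hlo hinj hlam hcount hEF₁ hEF₂

/-- ★★★ TYPED FOR CITATION: `CovZonoHard` (§8) RESTRICTED TO CLIQUE-ZONE FAMILIES — `gen i = λ_i • corVec ⊤ (S_i)` with distinct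
patterns and positive lengths (wlog for such families: equal patterns merge, zero lengths drop). -/
def CovZonoHardClique : Prop :=
  ∀ C : ℕ, ∃ h₀ : ℕ, ∀ h ≥ h₀,
    ∀ (M : ℕ) (pat : Fin M → (Fin h → Bool)) (lam : Fin M → ℝ) (w : Fin h × Fin h → ℝ) (r : ℕ),
      Function.Injective pat → (∀ i, 0 < lam i) →
      Covers h (2 * (Nat.log 2 h + C) ^ C + 4) (fun i => cliqueZone (lam i) (pat i)) →
      HasEFOfSize (convexHull ℝ (Set.range (subsetSum (fun i => cliqueZone (lam i) (pat i)) w))) r →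
        2 ^ ((Nat.log 2 h + C) ^ C) < r

/-- ★★★ PROVED. -/
theorem covZonoHardClique_holds : CovZonoHardClique := covZonoHard_cliqueZone_eventually

end Asymptotics

end Summit.ValiantsHypothesis.ValiantsHypothesis.Cruxes.NNDivisionHard.FaceBlind41

end
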